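import Literature.MathematicalPhysics.QuantumFieldTheory.Balaban1983to89.T4OutputRate

/-!
# T4HistoryLipschitzRecursion — NE9 ∧ FadingMemory BY INDUCTION ON THE CREATION STEP from ONE typed Lipschitz hypothesis
on the renormalization-group recursion (cell `pub-balaban`, T4-DAG §2 node U3 / §5 row T4-U3.E / §6 NE9; fan-out seat
NE9-P2, the INDUCTIVE member; typing + bookkeeping only)

HONEST FRAMING (T4-DAG PAGE 1).  The cell's T4 target is rung (B)+1 — existence AND uniqueness of the ε → 0 limit of
Bałaban's unit-scale averaged expectations on a FIXED finite torus; NOT infinite volume, NOT a mass gap, NOT the Clay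
problem.  NE9 — a quantitative, JOINT Lipschitz dependence of the scale-j output term `E^{(j)}(X; g₀, …, g_{j−1}, U)` on
the whole coupling history, with history moduli `Λ j i` whose memory of `g_i` FADES in the age `j − i`
(`T4OutputRate.NE9`, `T4OutputRate.FadingMemory`) — is NOT PRINTED in [Balaban1987RG1], [Balaban1988Convergent],
[Balaban1989LargeFieldII] (located absence: cell record `t4/T4-XREAD-U3.md` §2 (c2); GAPS G-t4-U3-1, G-t4-U3-3).  This
module does NOT prove NE9.  It proves, in the kernel, that NE9 ∧ FadingMemory FOLLOW from ONE per-step inequality on the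
recursion that generates the terms — `StepLipschitz`: the term created at step k + 1 is Lipschitz in the LAST coupling
g_k (constant `lam k`) and Lipschitz in the previously created terms, through which ALONE the earlier couplings enter
(constants `a k j`, j = creation step of the old term) — by strong induction on the creation step, for an ARBITRARY
window of coupling histories (no product structure, no coordinatewise telescoping: the two histories are compared
directly), and that the geometric contraction bound `a k j ≤ c·ω^{k−j}` (ω = per-step contraction of an old, irrelevant
term; c = the step map's Lipschitz constant in the old-term direction) produces the explicit moduli
`Λ k i = ℓ(ω + c)^{k−1−i}`, i.e. `FadingMemory (ℓ/(ω+c)) (ω+c)`.  The memory FADES iff `ω + c < 1`; that smallness,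
`c < 1 − ω`, is the load-bearing UNPRINTED input (node U5b consumes the rate through
`T4OutputRate.historySum_le_of_fadingMemory`, which needs rate < 1); for `ω + c ≥ 1` the same theorem still yields NE9,
with non-decaying moduli (the `T4OutputRate.historySum_const` regime).  A per-step version (`prodModuli`, one factor
`μ_m ≥ ω_m + c` per step m) makes the fading-memory factor explicit step by step.  Value = kernel reduction + ONE typed
missing inequality + ONE typed smallness condition; NOT summit progress.  The conditional inputs of the cell's other nodes
(BetaPertH, (B), (B^μ)) are not touched here.

WHAT IS PRINTED ABOUT THE RECURSION (journal pages of [Balaban1987RG1] read by this seat on the ×2 renders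
`b2b-balaban-ref1/pages/1987-cmp109-rg-I-small-field/`; quoted as CONTEXT for the SHAPE of the hypotheses — the manuscript
is the object under audit and is not cited for any estimate):
* p. 256, before (0.23): *"In the second step a new expression of this type is created, in the old only a background field
  is changed. Thus we obtain after k steps 𝐄_k(U_k) = Σ_{j=1}^{k} [−β_j(g_{j−1})A^η(U_k) + 𝐄^{(j)}(U_k)]. (0.23)"* and *"The
  function 𝐄_k depends also on the effective coupling constants g₀, …, g_{k−1}. It is a sum of contributions coming from
  the k successive integrations in the k renormalization transformations."* — terms are FIXED AT BIRTH (creation steps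
  j = 1, …, k; none at step 0), and the step-j term carries the couplings g₀, …, g_{j−1}.
* p. 268 (2.13), as printed: *"𝐄^{(k+1)}(g_k, U_{k+1}) = log ∫ dμ_{C^{(k)}}(B)χ_k exp[𝐏^{(k)}(g_k, U_{k+1}, B) + {...}].
  (2.13)"*, the curly bracket `{...}` being the last line of (2.12) on the same page, *"+ {𝐄_k(U_k(exp i[g_kCB −
  hD̃(g_kCB)]V^{(k)})) − 𝐄_k(U_k(V^{(k)}))}"* (p. 268: *"another is the expression in the curly bracket {...}"*), and *"Let us
  remark that the expression under the exponential above vanishes at g_k = 0"* — the NEW term depends on the last coupling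
  g_k explicitly, and on the earlier couplings ONLY through the fluctuation difference {…} of the OLD terms.  (v1 spliced
  the bracket's content from (2.12) into the quotation of (2.13); corrected here after the cell's cross-read
  `t4/T4-XREAD-NE9P2.md` M1 — a quotation-hygiene fix, no change of reading.)
* p. 270: *"The problem we consider in this section is connected with terms in the curly bracket in (2.12). We want to
  represent them as a sum of localized, irrelevant terms, i.e. terms satisfying the bound (0.28)."*; p. 258 (0.29)–(0.30):
  *"|𝐕^{(j)}(X, U_k)| ≤ O(1)(L^jη)^{4+α} exp(−κd_j(X)), α > 0, (0.29)"*, summed per creation step to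
  *"= Σ_{j=1}^{k} O(1)(L^jη)^α M^{−4}|T_1^{(k)}| ≤ O(1)(1 − L^{−α})^{−1}M^{−4}|T_1^{(k)}|. (0.30)"* — an old term's weight per
  unit current volume contracts by the factor `L^{−α}` per step: the printed origin of the per-step contraction `ω` below
  (printed for the terms THEMSELVES; for their coupling-DIFFERENCES it is part of the hypothesis).
* p. 263 (1.18)–p. 264: the new term is *"a C^∞-function of g_{j−1} ∈ [0, γ], (or analytic)"*, β_{j} *"uniformly bounded on
  this interval together with all derivatives"* — a LAST-coupling modulus exists qualitatively; no constant is printed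
  (cell record `t4/T4-EST-U3.md` §4 NE9-LAST).

NOT PRINTED, typed here as hypothesis SHAPES (binders; nothing asserted): `StepLipschitz` (both constant families), the
contraction bound on `a k j` for coupling-differences, the smallness `ω + c < 1`; (§6) `OuterLipschitz`, and the
creation-step-weighted, class-level form of `ChannelSize` — (§7, v1.2) reduced to the printed step-sum structure plus the
per-creation-step form `ChannelSizeAtStep` ((1.36) for the step-j sub-sum with the pre-summation constant of p. 8), which
remains the reading; the j-summed uniform form `ChannelSizeUniform` is the printed TYPE of (1.36) itself.

v1.1 — §6 THE LINEAR CHANNEL (where the old-term constants come from).  The constants `a k j` of `StepLipschitz` are NOT an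
independent estimate.  The earlier couplings reach the new term through the curly bracket of (2.12) p. 268, which is a
DIFFERENCE OF TWO EVALUATIONS of the old action 𝐄_k = Σ_j Σ_X (terms) — hence ADDITIVE in the family of old terms — and
whose localization in [Balaban1988RG2Cluster] (B13; CMP 116, renders `b2b-balaban-ref1/pages/1988-cmp116-rg-II-cluster/`,
PDF page = journal page, read by this seat as images) is performed TERM BY TERM and bounded LINEARLY in the old terms'
uniform size constant E₀, with ONE factor L^jη = L^{−(k−j)} per creation step j controlling the sum over j.  Printed
CONTEXT (quoted for the SHAPE of the §6 binders, not as facts): Lemma 1 p. 9, *"E_k(U_k(exp iB′V^{(k)})) − E_k(U_k(V^{(k)}))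
= Σ_{Y∈D_k} V′_k(Y, U_{k+1}, B). (1.33)"* with *"|V′_k(Y, U, J, B)| ≤ E₀ε₁C₁M^q exp C₂κ₁ exp(−(1−2δ)κd_k(Y)). (1.36)"*; the
one-term representation (1.23) p. 7 and its bound *"|(1.23)| ≤ 8B₀C₁e^{16κ₁}α₂^{−1}g_k|B|E₀(α₁/α₃)^5(L^jη)^5 · exp(−(κ₁ −
1)M^{−4}|Y₀∖□̃⁴|)exp(−κd_j(X)). (1.24)"*; p. 7 *"Now we consider the sum of all terms (1.23) having the same localization
domain Y. It is a sum over all admissible □₀, Y₀, j and X."*; p. 8 *"To bound the first sum, over □′ ⊂ □̃², we use the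
factor (L^jη)^5 in (1.24). This yields (6L)^4L^jη, and the sum over j is bounded by 2(6L)^4."* and *"almost all of them
are quite general and can be applied to all terms in the fluctuation field action"*; p. 9 *"The first term under the
exponential gives also the factor L^jη, which controls the sum over j"*.  The potentials then enter the cluster expansion
of the new term NON-linearly but analytically: (2.14) p. 15 carries `exp[Σ_{Y∈𝐃} τ(Y)𝐕_k(Y, B)]` with complex parameters
τ(Y) (*"We consider it as an analytic function of (𝐔, 𝐉) in the space 𝐔^c_{k+1}(X, α₀, α₁), and of the complex parameters
σ(Z), τ."*), and the output is again linear in E₀: p. 19 *"denoting ε₂ = 2E₀ε₁C₁α₄^{−1}α₆^{−1}M^q exp C₂κ₁"*, (2.35).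
§6 TYPES this as: an admissible class of term functionals closed under differences (`AdmissibleTerms`); an ADDITIVE channel
`T k s : old terms ↦ (ι → ℝ)` (`ChannelAdditive`; ι ↔ the arguments (Y, U_{k+1}, B) of V′_k); a CLASS-LEVEL, creation-step-
weighted SIZE bound `|T k s H y| ≤ wt k y · Σ_{j≤k} τ k j · N j` whenever `|H| ≤ N j·e^{−κd}` at the steps j ≤ k
(`ChannelSize`; `τ k j` ↔ O(1)L^{−(k−j)}, `wt` ↔ ε₁C₁M^qe^{C₂κ₁}e^{−(1−2δ)κd_k(Y)} — the weighted class-level form is this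
seat's READING of pp. 7–9, the printed statement (1.36) has the uniform E₀); and ONE outer hypothesis `OuterLipschitz`: the
new term depends on the history only through (g_k, channel output), Lipschitz in majorant form with constants `lam k` and
`cΦ k` (NOT PRINTED; in the tree the activity ↦ output half of such a constant is kernel-derived from the printed
Kotecký–Preiss letters of (2.41) p. 21 — `T4ActivityLipschitz.norm_locE_sub_locE_le_of_small`, relative activity distance ε
↦ 8ε·(eνc₁K₀²) — while the potential ↦ activity half, a Cauchy pencil in the τ(Y) of (2.14), is not; neither is imported
here).  KERNEL (§6): additivity + size ⇒ the DIFFERENCE bound (`channelDiff_of_size`) ⇒ `StepLipschitz E W κ lam (fun k j =>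
cΦ k * τ k j)` (`stepLipschitz_of_linearChannel`) ⇒ under `τ k j ≤ τ̄ω^{k−j}`, `cΦ k ≤ c̄`: NE9 ∧ FadingMemory at rate
`ω + c̄τ̄` (`ne9_and_fadingMemory_of_linearChannel`).  So the cell's unprinted old-term input REDUCES to the weighted size
bound of the localization channel plus one outer constant, and the smallness `c < 1 − ω` reads `c̄τ̄ < 1 − ω` (ω ↔ L^{−1},
τ̄ ∝ ε₁C₁M^qe^{C₂κ₁}): an ε₁-smallness of the TYPE printed for SIZES on p. 18, *"Assuming 2E₀ε₁C₁α₄^{−1}α₆^{−1}M^q exp C₂κ₁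
exp 5κ ≤ 1"* — for differences it remains the hypothesis.  The toy recursion of §5 passes through §6 (`toy_linearChannel`).

v1.2 — §7 PER-CREATION-STEP CHANNEL BOUNDS AND THE UNIFORM FORM (what the weights are for).  (a) The weighted class-level
`ChannelSize … τ` of §6 is DERIVED in the kernel (`channelSize_of_perStep`) from the printed STEP-SUM structure of the
channel — (1.33) p. 9 is a sum over the creation steps j of the one-term localizations (1.23) p. 7 (`ChannelStepSum`; itself
= additivity + locality on a linear class, `channelStepSum_of_local`) — plus a size bound with ONE uniform constant for the
sub-family created AT EACH STEP j SEPARATELY (`ChannelSizeAtStep`, `τ k j` ↔ the constant O(1)·(6L)^4·L^jη that p. 8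
l. 9–10 prints BEFORE performing the sum over j).  So the reading recorded under GAPS G-ne9p2-4 shrinks from «Lemma 1 re-run
with creation-step-dependent constants N_j» to «(1.36) holds for the step-j sub-sum of (1.33) with the pre-summation
constant», class-level.  (b) The LITERALLY PRINTED TYPE of Lemma 1 — ONE constant, the sum over j performed ((1.36) with
p. 8 *"the sum over j is bounded by 2(6L)^4"*) — is typed as `ChannelSizeUniform … τu` and gives, by its own strong
induction with a uniform majorant (`ne9_of_uniformChannel`), `NE9` with the moduli `ℓ·max(1, K)^{k−1−i}`, `K := c̄·τu` =
the Lipschitz constant of the one-step map {old terms} ↦ {new term} in the uniform decay norm: BOUNDED history moduli iff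
`K ≤ 1` (`ne9_bounded_of_uniformChannel`), and NO fading in the age.  (c) That loss is real, not an artefact of the proof:
the STICKY recursion `E_{k+2} = g_{k+1} + K·E_1` (§7b) satisfies every hypothesis of (b) with any `0 < K < 1`, has NE9 with
moduli ≤ 1, and admits NO moduli family with `FadingMemory C₉ ω`, ω < 1 (`sticky_not_fadingMemory`) — so the
UNIFORM hypothesis set is INSUFFICIENT for NE9-FADE: some age-sensitive input is needed, and the per-step weights
`L^{−(k−j)}` of pp. 8–9 are the sufficient one this module uses («necessary» in that sense only; v1.3 wording, cell
XREAD C-pv15g8-4 R6).  (d) The smallness is identified (`fade_iff_contraction`,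
`fadeRate_eq`): with geometric weights `τ k j ≤ τ̄ω^{k−j}` one has `τu ≤ τ̄/(1−ω)` (`sum_geometricWeights_le`) and
NE9-FADE `ω + c̄τ̄ < 1` ⟺ `K∞ := c̄τ̄/(1−ω) < 1`, rate `= 1 − (1−ω)(1−K∞)`: the cell's unprinted hypothesis (GAPS G-ne9p2-3)
says exactly that the RG step is a STRICT CONTRACTION of old-term DIFFERENCES in the uniform decay norm; the companion leaf
`T4HistoryLipschitzOuter` §5 (v1.2) types the same condition as a lower bound on the analyticity radius of the new-term map
in the potentials.  Nothing of (a)–(d) is an estimate on Bałaban's objects; (a) narrows a reading, (b)–(d) are kernel facts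
about the typed shapes.

v1.3 — §8 SIGN-GUARDED BINDERS (APPEND-ONLY; cell XREAD C-pv15g8-4 remark R5).  The size binders `ChannelSize` (§6) and `ChannelSizeAtStep` (§7)
quantify their majorant constants over ALL reals; at a creation step that carries no domain the size hypothesis is vacuous
for every real constant, so with a positive weight the binder is unsatisfiable there (an artefact of the typing, not of the
reading: in print every 𝐃_j, j ≥ 1, is inhabited and the constants are sups, hence ≥ 0).  §8 adds the SIGN-GUARDED forms
`StepLipschitzNN`, `ChannelSizeNN`, `ChannelSizeAtStepNN` (majorants `≥ 0` only — weaker hypotheses), re-derives every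
consumer from them (`ne9_of_stepLipschitzNN`, `stepLipschitzNN_of_linearChannelNN`, `channelSizeNN_of_perStepNN`,
`ne9_and_fadingMemory_of_linearChannelNN`, `ne9_and_fadingMemory_of_perStepNN`, `channelSizeUniform_of_weightedNN`; the
induction majorants `Σ_{i<j} Λ j i|g_i − g′_i|` are ≥ 0 for the product moduli), and proves that the unguarded binders are
RECOVERED from the guarded ones exactly under the instantiation-side cure — weight zero at uninhabited creation steps
(`channelSizeAtStep_of_NN`, `channelSize_of_NN`).  No statement of §1–§7 changes.

RELATION TO THE TREE.  `T4OutputRate` (node-U3 shapes NE9 / FadingMemory, three-bracket bookkeeping, `historySum_*`),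
`T4CouplingMatching.HistLipschitz` / `.FadingMemory` (the β-side twins, node U2) and `Dimock2015.AnalyticLipschitz` (the
Cauchy step analyticity-with-margin ⇒ a Lipschitz constant: ONE printed way to produce `lam k` and `c`, yielding UNIFORM
constants only — fading memory is not a consequence of analyticity) are imported or named, never modified.  Boundary
functionals (`T4BoundaryCarrier.BFunctional`, `NE9Fl B W κ Λ := ∀ a ∈ admFl, NE9 (atFl B a) W κ Λ`) and the recent-scale
terms R^{(j)} are covered by applying the theorems below to `atFl B a` at each admissible pending field `a`, resp. to the
R-family, as `Functional`s.  The parallel fan-out seat NE9-P1 (analytic member) derives moduli coordinatewise on the box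
window by Cauchy estimates and solves the renewal recursion for the moduli NUMBERS; this module states the step hypothesis
on the FUNCTIONAL, for any window, and proves the passage step-inequality ⇒ NE9 itself.

MATHEMATICAL CONTENT: real-number bookkeeping — a Fubini swap of a finite double sum, strong induction on the creation step,
an induction along the steps for the product super-solution, `Finset.prod_le_prod`; a toy recursion attaining the
constants; (§6) one subtraction under an additive map; (§7) a triangle inequality over the creation steps, finite additivity
along truncations, a second strong induction with a monotone uniform majorant, a geometric sum, and a two-history witness
against fading (`exists_pow_lt_of_lt_one`); (§8) the same subtraction / induction with majorants restricted to `≥ 0` and a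
`max · 0` replacement recovering the unguarded forms.  Every theorem is elementary ([folklore]); the [cite: …] tags locate the printed
CONTEXT of each hypothesis shape.
-/

noncomputable section

namespace Literature.MathematicalPhysics.QuantumFieldTheory.Balaban1983to89.T4HistoryLipschitzRecursion

open scoped BigOperators
open Literature.MathematicalPhysics.QuantumFieldTheory.Balaban1983to89.T4OutputRate

variable {C : Carriers}

/-! ## §1 Hypothesis shapes (binders only — nothing asserted) -/

/-- SHAPE S-BASE (printed structure, typed as a binder): no output term is created before the first step — (0.23) p. 256
sums over the creation steps j = 1, …, k — so a domain of creation step 0 carries a coupling-independent (in practice: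
absent) term.  `T4OutputRate.NE9` demands exactly this at scale 0 (empty history sum). [cite: Balaban1987RG1, (0.23) p.256] -/
def ScaleZeroFree {Bg : Type} (E : Functional C Bg) (W : Set (ℕ → ℝ)) : Prop :=
  ∀ g ∈ W, ∀ g' ∈ W, ∀ (U : Bg) (X : C.Dom), C.scale X = 0 → E g U X = E g' U X

/-- SHAPE S-STEP (cell NEW ESTIMATE, NOT PRINTED — the ONE per-step inequality of this module), in MAJORANT FORM: for two
coupling histories g, g′ of the window and ANY majorant `D j` of the decay-weighted differences of the terms created at the
steps j ≤ k, the difference of the term created at step k + 1 is at most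
`e^{−κd(X)}·(lam k·|g_k − g′_k| + Σ_{j≤k} a k j·D j)`.  This is what the structure of (2.13) p. 268 gives IF the step map
{last coupling, old terms} ↦ new term is Lipschitz: constant `lam k` in the explicit g_k (entering through g_kCB,
hD̃(g_kCB), 𝐏^{(k)}(g_k, ·); print: *"vanishes at g_k = 0"*, and p. 263 *"C^∞-function of g_{j−1}"* without a constant),
constants `a k j` in the old terms created at step j, which enter ONLY through the curly bracket
{𝐄_k(U_k(exp i[…]V^{(k)})) − 𝐄_k(U_k(V^{(k)}))} (p. 270: to be represented *"as a sum of localized, irrelevant terms"*).  The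
majorant form is implied by, and weaker than, the two Lipschitz properties of the step map in the weighted sup-norms; it is
stated on the functional so that no model of the step map is needed.  No constant of either kind is printed in
[Balaban1987RG1] / [Balaban1988Convergent] (cell records `t4/T4-XREAD-U3.md` §2 (c2), `t4/T4-EST-U3.md` §4).
[cite: Balaban1987RG1, (2.12)-(2.13) p.268 and §3 p.270] -/
def StepLipschitz {Bg : Type} (E : Functional C Bg) (W : Set (ℕ → ℝ)) (κ : ℝ) (lam : ℕ → ℝ)
    (a : ℕ → ℕ → ℝ) : Prop :=
  ∀ g ∈ W, ∀ g' ∈ W, ∀ (D : ℕ → ℝ) (k : ℕ),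
    (∀ (U' : Bg) (X' : C.Dom), C.scale X' ≤ k →
        |E g U' X' - E g' U' X'| ≤ Real.exp (-(κ * C.d X')) * D (C.scale X')) →
      ∀ (U : Bg) (X : C.Dom), C.scale X = k + 1 →
        |E g U X - E g' U X| ≤
          Real.exp (-(κ * C.d X)) * (lam k * |g k - g' k| + ∑ j ∈ Finset.range (k + 1), a k j * D j)

/-- The RENEWAL INEQUALITIES for candidate history moduli `Λ` (pure arithmetic): the last-coupling modulus of the term
created at step k + 1 dominates `lam k`, and for an OLDER coupling g_i (i < k) the modulus dominates what is inherited
through the terms created at the steps j = i + 1, …, k: `Σ_{j=i+1}^{k} a k j · Λ j i ≤ Λ (k+1) i`.  Any family satisfying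
them (a "super-solution") is a family of NE9 moduli (`ne9_of_stepLipschitz`). [folklore] -/
def RenewalSuper (lam : ℕ → ℝ) (a : ℕ → ℕ → ℝ) (Λ : ℕ → ℕ → ℝ) : Prop :=
  (∀ k, lam k ≤ Λ (k + 1) k) ∧
    ∀ k i, i < k → ∑ j ∈ Finset.Ico (i + 1) (k + 1), a k j * Λ j i ≤ Λ (k + 1) i

/-! ## §2 NE9 from the step inequality, by strong induction on the creation step -/

/-- FUBINI + COMPARISON (the arithmetic of the induction step): for nonnegative discrepancies `δ i`,
`lam k·δ k + Σ_{j≤k} a k j·(Σ_{i<j} Λ j i·δ i) ≤ Σ_{i≤k} Λ (k+1) i·δ i` whenever `Λ` satisfies the renewal inequalities —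
swap the finite double sum (`Finset.sum_comm'`) and compare coefficient by coefficient. [folklore] -/
theorem renewal_coeff_le {lam : ℕ → ℝ} {a Λ : ℕ → ℕ → ℝ} (hΛ : RenewalSuper lam a Λ) (k : ℕ)
    {δ : ℕ → ℝ} (hδ : ∀ i, 0 ≤ δ i) :
    lam k * δ k + ∑ j ∈ Finset.range (k + 1), a k j * ∑ i ∈ Finset.range j, Λ j i * δ i ≤
      ∑ i ∈ Finset.range (k + 1), Λ (k + 1) i * δ i := by
  have hswap : ∑ j ∈ Finset.range (k + 1), a k j * ∑ i ∈ Finset.range j, Λ j i * δ i =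
      ∑ i ∈ Finset.range (k + 1), (∑ j ∈ Finset.Ico (i + 1) (k + 1), a k j * Λ j i) * δ i := by
    simp_rw [Finset.mul_sum, Finset.sum_mul]
    have h : ∀ (x y : ℕ), x ∈ Finset.range (k + 1) ∧ y ∈ Finset.range x ↔
        x ∈ Finset.Ico (y + 1) (k + 1) ∧ y ∈ Finset.range (k + 1) := by
      intro x y
      simp only [Finset.mem_range, Finset.mem_Ico]
      omega
    rw [Finset.sum_comm' h]
    exact Finset.sum_congr rfl fun i _ => Finset.sum_congr rfl fun j _ => by ring
  rw [hswap, Finset.sum_range_succ, Finset.sum_range_succ, Finset.Ico_self, Finset.sum_empty, zero_mul,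
    add_zero]
  have h1 : lam k * δ k ≤ Λ (k + 1) k * δ k := mul_le_mul_of_nonneg_right (hΛ.1 k) (hδ k)
  have h2 : ∑ i ∈ Finset.range k, (∑ j ∈ Finset.Ico (i + 1) (k + 1), a k j * Λ j i) * δ i ≤
      ∑ i ∈ Finset.range k, Λ (k + 1) i * δ i :=
    Finset.sum_le_sum fun i hi => mul_le_mul_of_nonneg_right (hΛ.2 k i (Finset.mem_range.mp hi)) (hδ i)
  linarith

/-- **NE9 FROM THE STEP INEQUALITY.**  If no term is created at step 0 (`ScaleZeroFree`), the recursion satisfies the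
one-step Lipschitz inequality `StepLipschitz E W κ lam a`, and `Λ` satisfies the renewal inequalities for `(lam, a)`, then
`T4OutputRate.NE9 E W κ Λ` — for an ARBITRARY window `W` (no product structure is used: the two histories g, g′ are compared
directly, never through hybrid histories, so a window of RG TRAJECTORIES — cell record `t4/T4-XREAD-U3.md` V3 (iii) — is
admissible).  Strong induction on the creation step; the induction hypothesis supplies the majorant
`D j = Σ_{i<j} Λ j i |g_i − g′_i|`, and `renewal_coeff_le` closes the step. [folklore] -/
theorem ne9_of_stepLipschitz {Bg : Type} {E : Functional C Bg} {W : Set (ℕ → ℝ)} {κ : ℝ} {lam : ℕ → ℝ}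
    {a Λ : ℕ → ℕ → ℝ} (h0 : ScaleZeroFree E W) (hS : StepLipschitz E W κ lam a)
    (hΛ : RenewalSuper lam a Λ) : NE9 E W κ Λ := by
  suffices H : ∀ n, ∀ g ∈ W, ∀ g' ∈ W, ∀ (U : Bg) (X : C.Dom), C.scale X ≤ n →
      |E g U X - E g' U X| ≤
        Real.exp (-(κ * C.d X)) * ∑ i ∈ Finset.range (C.scale X), Λ (C.scale X) i * |g i - g' i| from
    fun g hg g' hg' U X => H _ g hg g' hg' U X le_rfl
  intro n
  induction n with
  | zero =>
    intro g hg g' hg' U X hX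
    have hX0 : C.scale X = 0 := Nat.le_zero.mp hX
    simp [h0 g hg g' hg' U X hX0, hX0]
  | succ n ih =>
    intro g hg g' hg' U X hX
    rcases Nat.lt_or_ge (C.scale X) (n + 1) with hlt | hge
    · exact ih g hg g' hg' U X (Nat.lt_succ_iff.mp hlt)
    · have hk : C.scale X = n + 1 := le_antisymm hX hge
      have hstep := hS g hg g' hg' (fun j => ∑ i ∈ Finset.range j, Λ j i * |g i - g' i|) n
        (fun U' X' h' => ih g hg g' hg' U' X' h') U X hk
      rw [hk]
      refine hstep.trans (mul_le_mul_of_nonneg_left ?_ (Real.exp_pos _).le)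
      exact renewal_coeff_le hΛ n (δ := fun i => |g i - g' i|) fun i => abs_nonneg _

/-! ## §3 Explicit super-solutions: one factor per step (products), and the geometric case -/

/-- The PRODUCT MODULI `Λ k i = ℓ · Π_{m=i+1}^{k−1} μ_m` for `i < k` (0 otherwise): the influence of g_i on the term created at
step k is the last-coupling constant `ℓ` at birth (k = i + 1) times ONE FACTOR `μ_m` PER LATER STEP m — the fading-memory
factor made explicit per step.  At a constant rate this is `ℓ μ^{k−1−i}` (`prodModuli_const`). [folklore] -/
def prodModuli (ℓ : ℝ) (μ : ℕ → ℝ) : ℕ → ℕ → ℝ :=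
  fun k i => if i < k then ℓ * ∏ m ∈ Finset.Ico (i + 1) k, μ m else 0

/-- Closed form at a constant rate: `prodModuli ℓ (fun _ => μ) k i = ℓ μ^{k−1−i}` for `i < k`, else 0. [folklore] -/
theorem prodModuli_const (ℓ μ : ℝ) (k i : ℕ) :
    prodModuli ℓ (fun _ => μ) k i = if i < k then ℓ * μ ^ (k - 1 - i) else 0 := by
  unfold prodModuli
  split_ifs with h
  · rw [Finset.prod_const, Nat.card_Ico]
    have e : k - (i + 1) = k - 1 - i := by omega
    rw [e]
  · rfl

/-- Nonnegativity of the product moduli for `ℓ ≥ 0`, `μ_m ≥ 0`. [folklore] -/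
theorem prodModuli_nonneg {ℓ : ℝ} {μ : ℕ → ℝ} (hℓ : 0 ≤ ℓ) (hμ : ∀ m, 0 ≤ μ m) (k i : ℕ) :
    0 ≤ prodModuli ℓ μ k i := by
  unfold prodModuli
  split_ifs
  · exact mul_nonneg hℓ (Finset.prod_nonneg fun m _ => hμ m)
  · exact le_rfl

/-- Value at birth: the modulus of the newest coupling is `ℓ` (empty product). [folklore] -/
theorem prodModuli_birth (ℓ : ℝ) (μ : ℕ → ℝ) (k : ℕ) : prodModuli ℓ μ (k + 1) k = ℓ := by
  simp [prodModuli]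

/-- One more step multiplies the modulus of an older coupling by that step's factor:
`prodModuli ℓ μ (k+2) i = prodModuli ℓ μ (k+1) i · μ_{k+1}` for `i ≤ k`. [folklore] -/
theorem prodModuli_succ (ℓ : ℝ) (μ : ℕ → ℝ) {k i : ℕ} (hik : i < k + 1) :
    prodModuli ℓ μ (k + 1 + 1) i = prodModuli ℓ μ (k + 1) i * μ (k + 1) := by
  unfold prodModuli
  rw [if_pos (by omega), if_pos hik, Finset.prod_Ico_succ_top (by omega), mul_assoc]

/-- **THE PRODUCT FAMILY IS A SUPER-SOLUTION** under the per-step CONTRACTION BOUND `a k j ≤ c · Π_{m=j+1}^{k} ω_m` (the term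
created at step j, seen by the step k + 1 through its fluctuation difference, has contracted by one factor `ω_m ≥ 0` per
intermediate step m — the coupling-difference analogue of (0.29)–(0.30) p. 258, NOT PRINTED), with a step-independent
Lipschitz constant `c ≥ 0` of the step map in the old-term direction, a uniform last-coupling constant `lam k ≤ ℓ`, and
per-step rates `μ_m ≥ ω_m + c`.  Induction along the steps: `S(k+1) = ω_{k+1}·S(k) + c·Λ(k+1, i) ≤ (ω_{k+1} + c)·Λ(k+1, i)
≤ Λ(k+2, i)`. [folklore] -/
theorem renewalSuper_prodModuli {lam : ℕ → ℝ} {a : ℕ → ℕ → ℝ} {ℓ c : ℝ} {ω μ : ℕ → ℝ} (hℓ : 0 ≤ ℓ)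
    (hc : 0 ≤ c) (hω : ∀ m, 0 ≤ ω m) (hμ : ∀ m, ω m + c ≤ μ m) (hlam : ∀ k, lam k ≤ ℓ)
    (ha : ∀ k j, j ≤ k → a k j ≤ c * ∏ m ∈ Finset.Ico (j + 1) (k + 1), ω m) :
    RenewalSuper lam a (prodModuli ℓ μ) := by
  have hμ0 : ∀ m, 0 ≤ μ m := fun m => (add_nonneg (hω m) hc).trans (hμ m)
  refine ⟨fun k => (hlam k).trans (prodModuli_birth ℓ μ k).ge, fun k i hik => ?_⟩
  have hterm : ∀ j ∈ Finset.Ico (i + 1) (k + 1),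
      a k j * prodModuli ℓ μ j i ≤
        c * (∏ m ∈ Finset.Ico (j + 1) (k + 1), ω m) * prodModuli ℓ μ j i := by
    intro j hj
    rw [Finset.mem_Ico] at hj
    exact mul_le_mul_of_nonneg_right (ha k j (by omega)) (prodModuli_nonneg hℓ hμ0 j i)
  refine (Finset.sum_le_sum hterm).trans ?_
  -- along the steps K = i, i+1, …: S(K) ≤ Λ(K+1, i)
  have key : ∀ K, i ≤ K →
      ∑ j ∈ Finset.Ico (i + 1) (K + 1),
          c * (∏ m ∈ Finset.Ico (j + 1) (K + 1), ω m) * prodModuli ℓ μ j i ≤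
        prodModuli ℓ μ (K + 1) i := by
    intro K hK
    induction K, hK using Nat.le_induction with
    | base =>
      rw [Finset.Ico_self, Finset.sum_empty]
      exact prodModuli_nonneg hℓ hμ0 _ _
    | succ K hK ih =>
      rw [Finset.sum_Ico_succ_top (by omega : i + 1 ≤ K + 1), Finset.Ico_self, Finset.prod_empty, mul_one,
        prodModuli_succ ℓ μ (by omega : i < K + 1)]
      have hsum : ∑ j ∈ Finset.Ico (i + 1) (K + 1),
          c * (∏ m ∈ Finset.Ico (j + 1) (K + 1 + 1), ω m) * prodModuli ℓ μ j i =
          ω (K + 1) * ∑ j ∈ Finset.Ico (i + 1) (K + 1),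
            c * (∏ m ∈ Finset.Ico (j + 1) (K + 1), ω m) * prodModuli ℓ μ j i := by
        rw [Finset.mul_sum]
        refine Finset.sum_congr rfl fun j hj => ?_
        rw [Finset.mem_Ico] at hj
        rw [Finset.prod_Ico_succ_top (by omega : j + 1 ≤ K + 1)]
        ring
      rw [hsum]
      have hP : 0 ≤ prodModuli ℓ μ (K + 1) i := prodModuli_nonneg hℓ hμ0 _ _
      calc ω (K + 1) * ∑ j ∈ Finset.Ico (i + 1) (K + 1),
              c * (∏ m ∈ Finset.Ico (j + 1) (K + 1), ω m) * prodModuli ℓ μ j i +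
            c * prodModuli ℓ μ (K + 1) i
          ≤ ω (K + 1) * prodModuli ℓ μ (K + 1) i + c * prodModuli ℓ μ (K + 1) i :=
            add_le_add (mul_le_mul_of_nonneg_left ih (hω _)) le_rfl
        _ = prodModuli ℓ μ (K + 1) i * (ω (K + 1) + c) := by ring
        _ ≤ prodModuli ℓ μ (K + 1) i * μ (K + 1) := mul_le_mul_of_nonneg_left (hμ _) hP
  exact key k hik.le

/-- GEOMETRIC CASE (one constant rate ω ≥ 0): under `a k j ≤ c ω^{k−j}` and `lam k ≤ ℓ` the family `ℓ(ω + c)^{k−1−i}`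
(`prodModuli ℓ (fun _ => ω + c)`) satisfies the renewal inequalities. [folklore] -/
theorem renewalSuper_geometric {lam : ℕ → ℝ} {a : ℕ → ℕ → ℝ} {ℓ c ω : ℝ} (hℓ : 0 ≤ ℓ) (hc : 0 ≤ c)
    (hω : 0 ≤ ω) (hlam : ∀ k, lam k ≤ ℓ) (ha : ∀ k j, j ≤ k → a k j ≤ c * ω ^ (k - j)) :
    RenewalSuper lam a (prodModuli ℓ fun _ => ω + c) := by
  refine renewalSuper_prodModuli hℓ hc (fun _ => hω) (fun _ => le_rfl) hlam fun k j hjk => ?_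
  rw [Finset.prod_const, Nat.card_Ico]
  have e : k + 1 - (j + 1) = k - j := by omega
  rw [e]
  exact ha k j hjk

/-- FADING MEMORY of the product family: if every per-step factor satisfies `0 ≤ μ_m ≤ μ̄` with `μ̄ > 0`, then
`T4OutputRate.FadingMemory (ℓ/μ̄) μ̄ (prodModuli ℓ μ)` — `Λ k i ≤ ℓ μ̄^{k−1−i} = (ℓ/μ̄) μ̄^{k−i}`. [folklore] -/
theorem fadingMemory_prodModuli {ℓ μbar : ℝ} {μ : ℕ → ℝ} (hℓ : 0 ≤ ℓ) (hμ0 : ∀ m, 0 ≤ μ m)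
    (hμ1 : ∀ m, μ m ≤ μbar) (hpos : 0 < μbar) : FadingMemory (ℓ / μbar) μbar (prodModuli ℓ μ) := by
  intro k i _
  refine ⟨prodModuli_nonneg hℓ hμ0 k i, ?_⟩
  unfold prodModuli
  split_ifs with h
  · calc ℓ * ∏ m ∈ Finset.Ico (i + 1) k, μ m ≤ ℓ * ∏ m ∈ Finset.Ico (i + 1) k, μbar :=
          mul_le_mul_of_nonneg_left (Finset.prod_le_prod (fun m _ => hμ0 m) fun m _ => hμ1 m) hℓ
      _ = ℓ / μbar * μbar ^ (k - i) := by
          rw [Finset.prod_const, Nat.card_Ico]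
          have hk : k - i = k - (i + 1) + 1 := by omega
          rw [hk, pow_succ, div_mul_eq_mul_div, eq_div_iff hpos.ne']
          ring
  · exact mul_nonneg (div_nonneg hℓ hpos.le) (pow_nonneg hpos.le _)

/-- The geometric family has fading memory with constant `ℓ/μ` and rate `μ = ω + c` (`μ > 0`). [folklore] -/
theorem fadingMemory_geometric {ℓ μ : ℝ} (hℓ : 0 ≤ ℓ) (hμ : 0 < μ) :
    FadingMemory (ℓ / μ) μ (prodModuli ℓ fun _ => μ) :=
  fadingMemory_prodModuli hℓ (fun _ => hμ.le) (fun _ => le_rfl) hμ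

/-! ## §4 The composed statements -/

/-- PER-STEP VERSION: `ScaleZeroFree`, `StepLipschitz E W κ lam a`, the per-step contraction bound
`a k j ≤ c·Π_{m=j+1}^{k} ω_m` and `lam k ≤ ℓ` give `T4OutputRate.NE9 E W κ (prodModuli ℓ μ)` for ANY per-step rates
`μ_m ≥ ω_m + c` — the influence of g_i on the step-k term is at most `ℓ·Π_{m=i+1}^{k−1}(ω_m + c)`. [folklore] -/
theorem ne9_of_productStep {Bg : Type} {E : Functional C Bg} {W : Set (ℕ → ℝ)} {κ ℓ c : ℝ} {ω μ : ℕ → ℝ}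
    {lam : ℕ → ℝ} {a : ℕ → ℕ → ℝ} (h0 : ScaleZeroFree E W) (hS : StepLipschitz E W κ lam a) (hℓ : 0 ≤ ℓ)
    (hc : 0 ≤ c) (hω : ∀ m, 0 ≤ ω m) (hμ : ∀ m, ω m + c ≤ μ m) (hlam : ∀ k, lam k ≤ ℓ)
    (ha : ∀ k j, j ≤ k → a k j ≤ c * ∏ m ∈ Finset.Ico (j + 1) (k + 1), ω m) :
    NE9 E W κ (prodModuli ℓ μ) :=
  ne9_of_stepLipschitz h0 hS (renewalSuper_prodModuli hℓ hc hω hμ hlam ha)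

/-- **HEADLINE — NE9 ∧ FADING MEMORY FROM THE STEP INEQUALITY WITH GEOMETRIC CONTRACTION.**  `ScaleZeroFree E W`,
`StepLipschitz E W κ lam a` with `lam k ≤ ℓ` and `a k j ≤ c·ω^{k−j}` (ℓ, c, ω ≥ 0, ω + c > 0) give, for ANY window W,
`T4OutputRate.NE9 E W κ Λ ∧ T4OutputRate.FadingMemory (ℓ/(ω+c)) (ω+c) Λ` with the explicit moduli `Λ k i = ℓ(ω+c)^{k−1−i}`.
The memory rate is `ω + c`: it FADES — and is useful downstream (`T4OutputRate.historySum_le_of_fadingMemory` needs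
rate < 1; `historyBracket_le_of_geometricStep`) — iff `c < 1 − ω`, the UNPRINTED smallness of the step map's Lipschitz
constant in the old-term direction against the per-step contraction; NE9 itself needs no smallness.  NOT a proof of NE9 for
Bałaban's terms: `StepLipschitz` and the contraction bound are the typed missing inequalities (cell GAPS rows of seat
NE9-P2). [folklore] -/
theorem ne9_and_fadingMemory_of_geometricStep {Bg : Type} {E : Functional C Bg} {W : Set (ℕ → ℝ)}
    {κ ℓ c ω : ℝ} {lam : ℕ → ℝ} {a : ℕ → ℕ → ℝ} (h0 : ScaleZeroFree E W) (hS : StepLipschitz E W κ lam a)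
    (hℓ : 0 ≤ ℓ) (hc : 0 ≤ c) (hω : 0 ≤ ω) (hpos : 0 < ω + c) (hlam : ∀ k, lam k ≤ ℓ)
    (ha : ∀ k j, j ≤ k → a k j ≤ c * ω ^ (k - j)) :
    NE9 E W κ (prodModuli ℓ fun _ => ω + c) ∧
      FadingMemory (ℓ / (ω + c)) (ω + c) (prodModuli ℓ fun _ => ω + c) :=
  ⟨ne9_of_stepLipschitz h0 hS (renewalSuper_geometric hℓ hc hω hlam ha), fadingMemory_geometric hℓ hpos⟩

/-- DOWNSTREAM (node U3's coupling bracket, by name): with the geometric moduli, `ω + c < 1`, and a uniform coupling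
discrepancy `|g^A_i − g^B_i| ≤ D` (node U2), the history bracket of `T4OutputRate.u3_threeBrackets` is bounded UNIFORMLY IN
THE CREATION STEP: `Σ_{i<j} Λ j i |g^A_i − g^B_i| ≤ (ℓ/(ω+c))·D·(1 − (ω+c))⁻¹` — `T4OutputRate.historySum_le_of_fadingMemory`.
[folklore] -/
theorem historyBracket_le_of_geometricStep {ℓ c ω : ℝ} (hℓ : 0 ≤ ℓ) (hpos : 0 < ω + c) (hsmall : ω + c < 1)
    {gA gB : ℕ → ℝ} {D : ℝ} (hD : ∀ i, |gA i - gB i| ≤ D) (j : ℕ) :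
    ∑ i ∈ Finset.range j, prodModuli ℓ (fun _ => ω + c) j i * |gA i - gB i| ≤
      ℓ / (ω + c) * D * (1 - (ω + c))⁻¹ :=
  historySum_le_of_fadingMemory (fadingMemory_geometric hℓ hpos) hpos.le hsmall hD j

/-! ## §5 A toy recursion attaining the constants (non-vacuity and sharpness of §4) -/

/-- Toy carriers: domains = creation steps, no decay length, trivial backgrounds. [folklore] -/
abbrev toyCarriers : Carriers where
  Dom := ℕ
  scale := id
  d := fun _ => 0
  d_nonneg := fun _ => le_rfl
  BgA := Unit
  BgB := Unit
  gauge := fun _ _ => 0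
  gauge_nonneg := fun _ _ => le_rfl
  transport := id

/-- The toy recursion `E_{k+1} = g_k + μ·E_k`, `E_0 = 0` (the newest old term re-enters with factor μ, the last coupling
enters with constant 1), in closed form `E_k(g) = Σ_{i<k} μ^{k−1−i} g_i`. [folklore] -/
def toyE (μ : ℝ) : Functional toyCarriers Unit :=
  fun g _ (k : ℕ) => ∑ i ∈ Finset.range k, μ ^ (k - 1 - i) * g i

/-- The toy recursion, one step. [folklore] -/
theorem toyE_succ (μ : ℝ) (g : ℕ → ℝ) (u : Unit) (k : ℕ) :
    toyE μ g u (k + 1) = g k + μ * toyE μ g u k := by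
  simp only [toyE]
  have hs : ∀ i ∈ Finset.range k, μ ^ (k + 1 - 1 - i) * g i = μ * (μ ^ (k - 1 - i) * g i) := by
    intro i hi
    rw [Finset.mem_range] at hi
    have e : k + 1 - 1 - i = k - 1 - i + 1 := by omega
    rw [e, pow_succ]
    ring
  have e0 : k + 1 - 1 - k = 0 := by omega
  rw [Finset.sum_range_succ, e0, pow_zero, one_mul, Finset.sum_congr rfl hs, ← Finset.mul_sum]
  ring

/-- The toy differences are EXACTLY `Σ_{i<k} μ^{k−1−i}(g_i − g′_i)`: the moduli `μ^{k−1−i}` returned by §4 (ℓ = 1, c = μ,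
ω = 0) are attained. [folklore] -/
theorem toyE_sub (μ : ℝ) (g g' : ℕ → ℝ) (u : Unit) (k : ℕ) :
    toyE μ g u k - toyE μ g' u k = ∑ i ∈ Finset.range k, μ ^ (k - 1 - i) * (g i - g' i) := by
  simp only [toyE, mul_sub, Finset.sum_sub_distrib]

/-- The toy recursion satisfies the step inequality with `lam ≡ 1` and `a k j = μ·[j = k]` (only the newest old term
re-enters), on any window, with κ = 0. [folklore] -/
theorem toy_stepLipschitz {μ : ℝ} (hμ : 0 ≤ μ) (W : Set (ℕ → ℝ)) :
    StepLipschitz (C := toyCarriers) (toyE μ) W 0 (fun _ => 1) (fun k j => if j = k then μ else 0) := by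
  intro g _ g' _ D k hD u X hX
  change X = k + 1 at hX
  subst hX
  have hk : |toyE μ g u k - toyE μ g' u k| ≤ D k := by simpa using hD u k (le_refl k)
  have hsum : ∑ j ∈ Finset.range (k + 1), (fun k j => if j = k then μ else 0) k j * D j = μ * D k := by
    simp [ite_mul, Finset.sum_ite_eq']
  rw [hsum]
  simp only [zero_mul, neg_zero, Real.exp_zero, one_mul]
  rw [toyE_succ, toyE_succ]
  calc |g k + μ * toyE μ g u k - (g' k + μ * toyE μ g' u k)|
      = |(g k - g' k) + μ * (toyE μ g u k - toyE μ g' u k)| := by ring_nf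
    _ ≤ |g k - g' k| + |μ * (toyE μ g u k - toyE μ g' u k)| := abs_add_le _ _
    _ = |g k - g' k| + μ * |toyE μ g u k - toyE μ g' u k| := by rw [abs_mul, abs_of_nonneg hμ]
    _ ≤ |g k - g' k| + μ * D k := by
        have := mul_le_mul_of_nonneg_left hk hμ
        linarith

/-- NON-VACUITY AND SHARPNESS: for the toy recursion the theorems of §2–§3 return `NE9` with the moduli
`prodModuli 1 (fun _ => μ) k i = μ^{k−1−i}` — equal to the true coefficients (`toyE_sub`) — and `FadingMemory (1/μ) μ`;
the memory fades iff μ < 1 (here ω = 0, c = μ). [folklore] -/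
theorem toy_ne9 {μ : ℝ} (hμ : 0 < μ) (W : Set (ℕ → ℝ)) :
    NE9 (C := toyCarriers) (toyE μ) W 0 (prodModuli 1 fun _ => μ) ∧
      FadingMemory (1 / μ) μ (prodModuli 1 fun _ => μ) := by
  refine ⟨ne9_of_stepLipschitz ?_ (toy_stepLipschitz hμ.le W) ?_,
    fadingMemory_prodModuli zero_le_one (fun _ => hμ.le) (fun _ => le_rfl) hμ⟩
  · intro g _ g' _ u X hX
    change X = 0 at hX
    subst hX
    simp [toyE]
  · refine renewalSuper_prodModuli (ω := fun _ => 0) zero_le_one hμ.le (fun _ => le_rfl)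
      (fun _ => by simp) (fun _ => le_rfl) fun k j _ => ?_
    split_ifs with h
    · subst h
      simp
    · exact mul_nonneg hμ.le (Finset.prod_nonneg fun _ _ => le_rfl)

/-! ## §6 (v1.1) The linear channel: the old-term constants `a k j` from an ADDITIVE localization map with a class-level
SIZE bound and ONE outer Lipschitz constant -/

/-- SHAPE S-ADM (binder): an admissible class of term functionals — in applications the functionals analytic on the
inductive analyticity domains (p. 7 of [Balaban1988RG2Cluster]: *"All terms (1.23) with the localization domain Y are
defined and analytic on this space."*) — containing the terms of every history of the window and CLOSED UNDER DIFFERENCES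
(a linear class). [cite: Balaban1988RG2Cluster, p.7 and (1.34) p.9] -/
def AdmissibleTerms {Bg : Type} (E : Functional C Bg) (W : Set (ℕ → ℝ)) (Adm : Set (Bg → C.Dom → ℝ)) : Prop :=
  (∀ g ∈ W, E g ∈ Adm) ∧ ∀ H₁ ∈ Adm, ∀ H₂ ∈ Adm, H₁ - H₂ ∈ Adm

/-- SHAPE S-ADD (printed structure, typed as a binder): the step-k localization channel `T k s` — old terms ↦ localized
fluctuation potentials, output index `y : ι` (↔ the arguments (Y, U_{k+1}, B) of V′_k(Y, U_{k+1}, B)), allowed to depend on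
the comparison history `s` (in print only through the explicit coupling s_k of B′ = g_kCB − hD̃(g_kCB), (3.2) p. 270 of
[Balaban1987RG1]) — is ADDITIVE in the old terms on the admissible class: the curly bracket of (2.12) p. 268 is a difference
of two evaluations of the old action 𝐄_k = Σ_j Σ_X (terms), and its localization (1.33) p. 9 is performed term by term
((1.10), (1.23) p. 7; p. 7: *"It is a sum over all admissible □₀, Y₀, j and X."*).
[cite: Balaban1987RG1, (2.12) p.268; Balaban1988RG2Cluster, (1.23) p.7, (1.33) p.9] -/
def ChannelAdditive {Bg ι : Type} (Adm : Set (Bg → C.Dom → ℝ))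
    (T : ℕ → (ℕ → ℝ) → (Bg → C.Dom → ℝ) → ι → ℝ) : Prop :=
  ∀ (k : ℕ) (s : ℕ → ℝ), ∀ H₁ ∈ Adm, ∀ H₂ ∈ Adm, ∀ y : ι, T k s (H₁ - H₂) y = T k s H₁ y - T k s H₂ y

/-- SHAPE S-SIZE (printed TYPE with a UNIFORM constant; the creation-step-weighted, class-level form is this seat's READING
of pp. 7–9 — binder): if the old terms created at the steps j ≤ k are bounded by `N j·e^{−κd}`, the channel output at
index y is bounded by `wt k y · Σ_{j≤k} τ k j · N j`.  Print: (1.36) p. 9 *"|V′_k(Y, U, J, B)| ≤ E₀ε₁C₁M^q exp C₂κ₁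
exp(−(1−2δ)κd_k(Y))"* is LINEAR in the old terms' uniform constant E₀ ((1.24) p. 7, (1.29) p. 8), and the sum over the
creation step j is controlled by one factor L^jη = L^{−(k−j)} per term (p. 8 l. 9–10, p. 9 l. 12–13): `wt k y` ↔
ε₁C₁M^qe^{C₂κ₁}e^{−(1−2δ)κd_k(Y)}, `τ k j` ↔ O(1)L^{−(k−j)}. [cite: Balaban1988RG2Cluster, (1.24) p.7, (1.29) p.8, (1.36) p.9] -/
def ChannelSize {Bg ι : Type} (Adm : Set (Bg → C.Dom → ℝ)) (T : ℕ → (ℕ → ℝ) → (Bg → C.Dom → ℝ) → ι → ℝ)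
    (κ : ℝ) (wt : ℕ → ι → ℝ) (τ : ℕ → ℕ → ℝ) : Prop :=
  ∀ (k : ℕ) (s : ℕ → ℝ), ∀ H ∈ Adm, ∀ (N : ℕ → ℝ),
    (∀ (U : Bg) (X : C.Dom), C.scale X ≤ k → |H U X| ≤ Real.exp (-(κ * C.d X)) * N (C.scale X)) →
      ∀ y : ι, |T k s H y| ≤ wt k y * ∑ j ∈ Finset.range (k + 1), τ k j * N j

/-- SHAPE S-OUTER (cell NEW ESTIMATE, NOT PRINTED — binder): the term created at step k + 1 depends on the coupling history
ONLY through the explicit last coupling g_k and the channel output `T k g′ (E g)` ((2.13) p. 268: 𝐏^{(k)}(g_k, U_{k+1}, B)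
+ {...}), and is Lipschitz in both, in MAJORANT form: constants `lam k` (explicit coupling; print: *"C^∞-function of
g_{j−1}"* p. 263, no constant) and `cΦ k` (channel output ↦ new term, through the cluster expansion (2.13)–(2.15) of
[Balaban1988RG2Cluster], where the potentials enter through `exp[Σ_{Y∈𝐃} τ(Y)𝐕_k(Y, B)]` of (2.14) p. 15; the tree's
`T4ActivityLipschitz.norm_locE_sub_locE_le_of_small` kernel-derives the activity ↦ output half of such a constant from the
printed letters of (2.41) p. 21; the potential ↦ activity half is not in the tree).
[cite: Balaban1987RG1, (2.13) p.268; Balaban1988RG2Cluster, (2.14)-(2.15) p.15] -/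
def OuterLipschitz {Bg ι : Type} (E : Functional C Bg) (W : Set (ℕ → ℝ))
    (T : ℕ → (ℕ → ℝ) → (Bg → C.Dom → ℝ) → ι → ℝ) (κ : ℝ) (wt : ℕ → ι → ℝ) (lam cΦ : ℕ → ℝ) : Prop :=
  ∀ g ∈ W, ∀ g' ∈ W, ∀ (k : ℕ) (M : ℝ),
    (∀ y : ι, |T k g' (E g) y - T k g' (E g') y| ≤ wt k y * M) →
      ∀ (U : Bg) (X : C.Dom), C.scale X = k + 1 →
        |E g U X - E g' U X| ≤ Real.exp (-(κ * C.d X)) * (lam k * |g k - g' k| + cΦ k * M)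

/-- **ADDITIVITY + SIZE ⇒ DIFFERENCE** (the point of §6): on the admissible class, a majorant `D j·e^{−κd}` of the
DIFFERENCE of two old-term families at the creation steps j ≤ k yields the majorant `wt k y·Σ_{j≤k} τ k j·D j` of the
difference of their channel outputs — the SIZE bound applied to `H₁ − H₂`.  No Lipschitz estimate of the channel is an
independent input. [folklore] -/
theorem channelDiff_of_size {Bg ι : Type} {Adm : Set (Bg → C.Dom → ℝ)}
    {T : ℕ → (ℕ → ℝ) → (Bg → C.Dom → ℝ) → ι → ℝ} {κ : ℝ} {wt : ℕ → ι → ℝ} {τ : ℕ → ℕ → ℝ}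
    (hadd : ChannelAdditive Adm T) (hsize : ChannelSize Adm T κ wt τ) {H₁ H₂ : Bg → C.Dom → ℝ} (h₁ : H₁ ∈ Adm)
    (h₂ : H₂ ∈ Adm) (h₁₂ : H₁ - H₂ ∈ Adm) (k : ℕ) (s : ℕ → ℝ) {D : ℕ → ℝ}
    (hD : ∀ (U : Bg) (X : C.Dom), C.scale X ≤ k → |H₁ U X - H₂ U X| ≤ Real.exp (-(κ * C.d X)) * D (C.scale X))
    (y : ι) : |T k s H₁ y - T k s H₂ y| ≤ wt k y * ∑ j ∈ Finset.range (k + 1), τ k j * D j := by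
  rw [← hadd k s H₁ h₁ H₂ h₂ y]
  exact hsize k s (H₁ - H₂) h₁₂ D (fun U X hX => by simpa only [Pi.sub_apply] using hD U X hX) y

/-- **THE STEP INEQUALITY FROM THE LINEAR CHANNEL**: `AdmissibleTerms`, `ChannelAdditive`, `ChannelSize … κ wt τ` and
`OuterLipschitz … κ wt lam cΦ` give `StepLipschitz E W κ lam (fun k j => cΦ k * τ k j)` — the old-term constants ARE the
outer constant times the channel's size weights. [folklore] -/
theorem stepLipschitz_of_linearChannel {Bg ι : Type} {E : Functional C Bg} {W : Set (ℕ → ℝ)}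
    {Adm : Set (Bg → C.Dom → ℝ)} {T : ℕ → (ℕ → ℝ) → (Bg → C.Dom → ℝ) → ι → ℝ} {κ : ℝ} {wt : ℕ → ι → ℝ}
    {τ : ℕ → ℕ → ℝ} {lam cΦ : ℕ → ℝ} (hAdm : AdmissibleTerms E W Adm) (hadd : ChannelAdditive Adm T)
    (hsize : ChannelSize Adm T κ wt τ) (hout : OuterLipschitz E W T κ wt lam cΦ) :
    StepLipschitz E W κ lam (fun k j => cΦ k * τ k j) := by
  intro g hg g' hg' D k hD U X hX
  have hM : ∀ y : ι, |T k g' (E g) y - T k g' (E g') y| ≤ wt k y * ∑ j ∈ Finset.range (k + 1), τ k j * D j :=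
    channelDiff_of_size hadd hsize (hAdm.1 g hg) (hAdm.1 g' hg') (hAdm.2 _ (hAdm.1 g hg) _ (hAdm.1 g' hg')) k g' hD
  have h := hout g hg g' hg' k _ hM U X hX
  simpa only [Finset.mul_sum, mul_assoc] using h

/-- **HEADLINE OF §6 — NE9 ∧ FADING MEMORY FROM THE LINEAR CHANNEL.**  With geometric channel weights
`0 ≤ τ k j ≤ τ̄·ω^{k−j}` (printed mechanism: ω ↔ L^{−1}), outer constants `0 ≤ cΦ k ≤ c̄` and `lam k ≤ ℓ` (ℓ, c̄, τ̄, ω ≥ 0,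
ω + c̄τ̄ > 0), the terms satisfy `NE9` with the moduli `ℓ(ω + c̄τ̄)^{k−1−i}` and `FadingMemory (ℓ/(ω + c̄τ̄)) (ω + c̄τ̄)`, for
ANY window; the memory FADES iff `c̄τ̄ < 1 − ω` — with τ̄ ∝ ε₁C₁M^qe^{C₂κ₁} an ε₁-smallness of the type printed for SIZES on
p. 18 of [Balaban1988RG2Cluster]; for differences it is the hypothesis (cell GAPS row G-ne9p2-3).  NOT a proof of NE9 for
Bałaban's terms: `ChannelSize` (weighted class-level form) and `OuterLipschitz` are the typed inputs. [folklore] -/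
theorem ne9_and_fadingMemory_of_linearChannel {Bg ι : Type} {E : Functional C Bg} {W : Set (ℕ → ℝ)}
    {Adm : Set (Bg → C.Dom → ℝ)} {T : ℕ → (ℕ → ℝ) → (Bg → C.Dom → ℝ) → ι → ℝ} {κ : ℝ} {wt : ℕ → ι → ℝ}
    {τ : ℕ → ℕ → ℝ} {lam cΦ : ℕ → ℝ} {ℓ cbar τbar ω : ℝ} (h0 : ScaleZeroFree E W)
    (hAdm : AdmissibleTerms E W Adm) (hadd : ChannelAdditive Adm T) (hsize : ChannelSize Adm T κ wt τ)
    (hout : OuterLipschitz E W T κ wt lam cΦ) (hℓ : 0 ≤ ℓ) (hc : 0 ≤ cbar) (hτbar : 0 ≤ τbar) (hω : 0 ≤ ω)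
    (hpos : 0 < ω + cbar * τbar) (hlam : ∀ k, lam k ≤ ℓ) (hcΦ : ∀ k, 0 ≤ cΦ k ∧ cΦ k ≤ cbar)
    (hτ : ∀ k j, j ≤ k → 0 ≤ τ k j ∧ τ k j ≤ τbar * ω ^ (k - j)) :
    NE9 E W κ (prodModuli ℓ fun _ => ω + cbar * τbar) ∧
      FadingMemory (ℓ / (ω + cbar * τbar)) (ω + cbar * τbar) (prodModuli ℓ fun _ => ω + cbar * τbar) :=
  ne9_and_fadingMemory_of_geometricStep h0 (stepLipschitz_of_linearChannel hAdm hadd hsize hout) hℓ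
    (mul_nonneg hc hτbar) hω hpos hlam fun k j hjk => by
      show cΦ k * τ k j ≤ cbar * τbar * ω ^ (k - j)
      calc cΦ k * τ k j ≤ cbar * (τbar * ω ^ (k - j)) := mul_le_mul (hcΦ k).2 (hτ k j hjk).2 (hτ k j hjk).1 hc
        _ = cbar * τbar * ω ^ (k - j) := (mul_assoc _ _ _).symm

/-- DOWNSTREAM OF §6 (node U3's coupling bracket, by name): under the smallness `ω + c̄τ̄ < 1` and a uniform coupling
discrepancy `|g^A_i − g^B_i| ≤ D`, the history bracket is bounded uniformly in the creation step by
`(ℓ/(ω + c̄τ̄))·D·(1 − (ω + c̄τ̄))⁻¹` (`historyBracket_le_of_geometricStep`). [folklore] -/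
theorem historyBracket_le_of_linearChannel {ℓ cbar τbar ω : ℝ} (hℓ : 0 ≤ ℓ) (hpos : 0 < ω + cbar * τbar)
    (hsmall : ω + cbar * τbar < 1) {gA gB : ℕ → ℝ} {D : ℝ} (hD : ∀ i, |gA i - gB i| ≤ D) (j : ℕ) :
    ∑ i ∈ Finset.range j, prodModuli ℓ (fun _ => ω + cbar * τbar) j i * |gA i - gB i| ≤
      ℓ / (ω + cbar * τbar) * D * (1 - (ω + cbar * τbar))⁻¹ :=
  historyBracket_le_of_geometricStep hℓ hpos hsmall hD j

/-- The toy channel of the toy recursion of §5: it reads the newest old term, `T k s H () = H () k`. [folklore] -/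
def toyChannel : ℕ → (ℕ → ℝ) → (Unit → ℕ → ℝ) → Unit → ℝ := fun k _ H _ => H () k

/-- NON-VACUITY OF THE §6 HYPOTHESIS SET: the toy recursion `E_{k+1} = g_k + μ·E_k` satisfies `AdmissibleTerms` (all
functionals), `ChannelAdditive`, `ChannelSize` with `wt ≡ 1`, `τ k j = [j = k]`, and `OuterLipschitz` with `lam ≡ 1`,
`cΦ ≡ μ` (κ = 0, any window). [folklore] -/
theorem toy_linearChannel {μ : ℝ} (hμ : 0 ≤ μ) (W : Set (ℕ → ℝ)) :
    AdmissibleTerms (C := toyCarriers) (toyE μ) W Set.univ ∧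
      ChannelAdditive (C := toyCarriers) Set.univ toyChannel ∧
      ChannelSize (C := toyCarriers) Set.univ toyChannel 0 (fun _ _ => 1) (fun k j => if j = k then 1 else 0) ∧
      OuterLipschitz (C := toyCarriers) (toyE μ) W toyChannel 0 (fun _ _ => 1) (fun _ => 1) (fun _ => μ) := by
  refine ⟨⟨fun _ _ => Set.mem_univ _, fun _ _ _ _ => Set.mem_univ _⟩, fun _ _ _ _ _ _ _ => rfl, ?_, ?_⟩
  · intro k s H _ N hN y
    have hk : |H () k| ≤ N k := by simpa using hN () k (le_refl k)
    have hsum : ∑ j ∈ Finset.range (k + 1), (fun k j => if j = k then (1 : ℝ) else 0) k j * N j = N k := by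
      simp [ite_mul, Finset.sum_ite_eq']
    rw [hsum, one_mul]
    exact hk
  · intro g _ g' _ k M hM u X hX
    change X = k + 1 at hX
    subst hX
    have hk : |toyE μ g () k - toyE μ g' () k| ≤ M := by simpa [toyChannel] using hM ()
    obtain ⟨⟩ := u
    simp only [zero_mul, neg_zero, Real.exp_zero, one_mul]
    rw [toyE_succ, toyE_succ]
    calc |g k + μ * toyE μ g () k - (g' k + μ * toyE μ g' () k)|
        = |(g k - g' k) + μ * (toyE μ g () k - toyE μ g' () k)| := by ring_nf
      _ ≤ |g k - g' k| + |μ * (toyE μ g () k - toyE μ g' () k)| := abs_add_le _ _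
      _ = |g k - g' k| + μ * |toyE μ g () k - toyE μ g' () k| := by rw [abs_mul, abs_of_nonneg hμ]
      _ ≤ |g k - g' k| + μ * M := by
          have := mul_le_mul_of_nonneg_left hk hμ
          linarith

/-- §6 returns, for the toy recursion, the step inequality of §5 with the constants `a k j = μ·[j = k]` — so the linear
channel loses nothing here (the moduli `μ^{k−1−i}` of `toy_ne9` are attained, `toyE_sub`). [folklore] -/
theorem toy_stepLipschitz_of_channel {μ : ℝ} (hμ : 0 ≤ μ) (W : Set (ℕ → ℝ)) :
    StepLipschitz (C := toyCarriers) (toyE μ) W 0 (fun _ => 1) (fun k j => μ * if j = k then 1 else 0) := by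
  obtain ⟨hAdm, hadd, hsize, hout⟩ := toy_linearChannel hμ W
  exact stepLipschitz_of_linearChannel hAdm hadd hsize hout

/-! ## §7 (v1.2) Per-creation-step channel bounds — the weighted size bound `ChannelSize` DERIVED from the printed
step-sum structure plus ONE uniform constant per creation step; the literally printed UNIFORM form, what it gives (NE9 with
bounded-or-growing moduli) and what it provably cannot give (fading memory) -/

/-- Restriction of a family of terms to the ONE creation step `j` — the step-j sub-family of the old action
`𝐄_k = Σ_{j=1}^{k}[…𝐄^{(j)}…]` ((0.23) p. 256 of [Balaban1987RG1]); zero on the domains of every other creation step.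
[cite: Balaban1987RG1, (0.23) p.256] -/
def restrictScale {Bg : Type} (j : ℕ) (H : Bg → C.Dom → ℝ) : Bg → C.Dom → ℝ :=
  fun U X => if C.scale X = j then H U X else 0

/-- On a domain of the creation step j the restriction is the family itself. [folklore] -/
theorem restrictScale_of_eq {Bg : Type} {j : ℕ} (H : Bg → C.Dom → ℝ) {U : Bg} {X : C.Dom} (h : C.scale X = j) :
    restrictScale j H U X = H U X := if_pos h

/-- Off the creation step j the restriction vanishes. [folklore] -/
theorem restrictScale_of_ne {Bg : Type} {j : ℕ} (H : Bg → C.Dom → ℝ) {U : Bg} {X : C.Dom} (h : C.scale X ≠ j) :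
    restrictScale j H U X = 0 := if_neg h

/-- Truncation of a family of terms to the creation steps `j ≤ k` — the old action present at the step k ((0.23) p. 256:
the sum runs to the current step). [cite: Balaban1987RG1, (0.23) p.256] -/
def truncScale {Bg : Type} (k : ℕ) (H : Bg → C.Dom → ℝ) : Bg → C.Dom → ℝ :=
  fun U X => if C.scale X ≤ k then H U X else 0

/-- The truncated family is the sum of its one-step restrictions (pointwise bookkeeping). [folklore] -/
theorem truncScale_eq_sum_restrictScale {Bg : Type} (k : ℕ) (H : Bg → C.Dom → ℝ) :
    truncScale k H = ∑ j ∈ Finset.range (k + 1), restrictScale j H := by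
  funext U X
  rw [Finset.sum_apply, Finset.sum_apply]
  simp only [truncScale, restrictScale]
  rw [Finset.sum_ite_eq]
  simp only [Finset.mem_range, Nat.lt_succ_iff]

/-- SHAPE S-RESTR (binder): the admissible class is closed under restriction to one creation step and under truncation
(a sub-family of terms analytic on the inductive domains is such a family; p. 7 of [Balaban1988RG2Cluster], *"All terms
(1.23) with the localization domain Y are defined and analytic on this space."*). [cite: Balaban1988RG2Cluster, p.7] -/
def AdmRestrict {Bg : Type} (Adm : Set (Bg → C.Dom → ℝ)) : Prop :=
  (∀ H ∈ Adm, ∀ j : ℕ, restrictScale j H ∈ Adm) ∧ ∀ H ∈ Adm, ∀ k : ℕ, truncScale k H ∈ Adm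

/-- SHAPE S-LOC (printed structure, binder): the step-k channel reads ONLY the terms created at the steps j ≤ k — (1.33)
p. 9 of [Balaban1988RG2Cluster] localizes `E_k(U_k(exp iB′V^{(k)})) − E_k(U_k(V^{(k)}))`, and E_k is the action after k
steps, (0.23) p. 256 of [Balaban1987RG1]. [cite: Balaban1988RG2Cluster, (1.33) p.9] -/
def ChannelLocal {Bg ι : Type} (Adm : Set (Bg → C.Dom → ℝ))
    (T : ℕ → (ℕ → ℝ) → (Bg → C.Dom → ℝ) → ι → ℝ) : Prop :=
  ∀ (k : ℕ) (s : ℕ → ℝ), ∀ H ∈ Adm, ∀ y : ι, T k s H y = T k s (truncScale k H) y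

/-- SHAPE S-SUM (printed structure, binder): the step-k channel output is the SUM over the creation steps j ≤ k of its
outputs on the one-step sub-families — (1.33) p. 9 sums the one-term contributions (1.23) p. 7, and p. 7: *"Now we consider
the sum of all terms (1.23) having the same localization domain Y. It is a sum over all admissible □₀, Y₀, j and X."*
(`channelStepSum_of_local`: no independent input on a linear class with a local additive channel).
[cite: Balaban1988RG2Cluster, (1.23) p.7, (1.33) p.9] -/
def ChannelStepSum {Bg ι : Type} (Adm : Set (Bg → C.Dom → ℝ))
    (T : ℕ → (ℕ → ℝ) → (Bg → C.Dom → ℝ) → ι → ℝ) : Prop :=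
  ∀ (k : ℕ) (s : ℕ → ℝ), ∀ H ∈ Adm, ∀ y : ι,
    T k s H y = ∑ j ∈ Finset.range (k + 1), T k s (restrictScale j H) y

/-- **STEP-SUM = ADDITIVITY + LOCALITY** on an admissible class closed under restrictions and truncations:
`ChannelAdditive` (§6) and `ChannelLocal` give `ChannelStepSum` — finite additivity along the partial sums
`truncScale m H = Σ_{j≤m} restrictScale j H`, which stay in the class. [folklore] -/
theorem channelStepSum_of_local {Bg ι : Type} {Adm : Set (Bg → C.Dom → ℝ)}
    {T : ℕ → (ℕ → ℝ) → (Bg → C.Dom → ℝ) → ι → ℝ}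
    (hres : AdmRestrict Adm) (hadd : ChannelAdditive Adm T) (hloc : ChannelLocal Adm T) :
    ChannelStepSum Adm T := by
  intro k s H hH y
  -- finite additivity along the partial sums, which are truncations and hence admissible
  have hfin : ∀ m : ℕ, T k s (truncScale m H) y = ∑ j ∈ Finset.range (m + 1), T k s (restrictScale j H) y := by
    intro m
    induction m with
    | zero =>
      rw [zero_add, Finset.sum_range_one]
      congr 1
      funext U X
      simp only [truncScale, restrictScale, Nat.le_zero]
    | succ m ih =>
      rw [Finset.sum_range_succ, ← ih]
      have hT : truncScale (m + 1) H = truncScale m H + restrictScale (m + 1) H := by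
        rw [truncScale_eq_sum_restrictScale, truncScale_eq_sum_restrictScale, Finset.sum_range_succ]
      have hdiff : truncScale (m + 1) H - restrictScale (m + 1) H = truncScale m H := by
        rw [hT, add_sub_cancel_right]
      have h := hadd k s (truncScale (m + 1) H) (hres.2 H hH (m + 1)) (restrictScale (m + 1) H)
        (hres.1 H hH (m + 1)) y
      rw [hdiff] at h
      linarith
  rw [hloc k s H hH y]
  exact hfin k

/-- SHAPE S-SIZE-j (the PER-CREATION-STEP form of the size bound — binder; this seat's reading of pp. 7–9 of
[Balaban1988RG2Cluster] at ONE creation step): a family supported at the single creation step `j ≤ k` and bounded there by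
`N·e^{−κd}` has channel output bounded by `wt k y · τ k j · N` — the TYPE of (1.36) p. 9 (*"|V′_k(Y, U, J, B)| ≤
E₀ε₁C₁M^q exp C₂κ₁ exp(−(1−2δ)κd_k(Y))"*, linear in the uniform constant E₀ of (1.29) p. 8) applied to the step-j sub-sum
of (1.33), with the constant that p. 8 l. 9–10 prints BEFORE the sum over j: *"To bound the first sum, over □′ ⊂ □̃², we use
the factor (L^jη)^5 in (1.24). This yields (6L)^4L^jη, and the sum over j is bounded by 2(6L)^4."* — `τ k j` ↔
O(1)·L^jη = O(1)·L^{−(k−j)}, `wt k y` ↔ ε₁C₁M^qe^{C₂κ₁}e^{−(1−2δ)κd_k(Y)}.  What (1.36) asserts is the j-SUMMED form with the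
uniform E₀ (`ChannelSizeUniform` below); the per-step form with `N` depending on j is NOT a printed statement.  SCOPE of
the reading (v1.3; cell XREAD C-pv15g8-3 and C-pv15g8-4, R1): per the DISPLAYED families (1.23)–(1.29), (1.30)–(1.32); the remaining
families by the printed analogy, p. 8 ¶2: *"We apply the expansion (1.10) to them, and the terms in this expansion can be
bounded similarly as in (1.24), using the inequalities (I.4.5), (I.4.22), (I.4.36), (I.5.44), and other inequalities
mentioned in the previous sections. The summation over all possible choices of □₀, Y₀, j, X yields an expression
satisfying (1.29)."* — not by a bound displayed in [Balaban1988RG2Cluster].  SIGN: `N` ranges over ALL reals (no `0 ≤ N`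
guard); at an UNINHABITED creation step with `wt·τ > 0` the shape is then unsatisfiable — use the guarded form
`ChannelSizeAtStepNN` of §8, or the instantiation-side cure `τ k j = 0` there (`channelSizeAtStep_of_NN`).
[cite: Balaban1988RG2Cluster, (1.24) p.7, (1.29) p.8, p.8 l.9-10, p.8 par.2, (1.36) p.9] -/
def ChannelSizeAtStep {Bg ι : Type} (Adm : Set (Bg → C.Dom → ℝ))
    (T : ℕ → (ℕ → ℝ) → (Bg → C.Dom → ℝ) → ι → ℝ) (κ : ℝ) (wt : ℕ → ι → ℝ) (τ : ℕ → ℕ → ℝ) : Prop :=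
  ∀ (k j : ℕ), j ≤ k → ∀ (s : ℕ → ℝ), ∀ H ∈ Adm,
    (∀ (U : Bg) (X : C.Dom), C.scale X ≠ j → H U X = 0) →
      ∀ N : ℝ, (∀ (U : Bg) (X : C.Dom), C.scale X = j → |H U X| ≤ Real.exp (-(κ * C.d X)) * N) →
        ∀ y : ι, |T k s H y| ≤ wt k y * (τ k j * N)

/-- **PER-STEP SIZE BOUNDS + STEP-SUM ⇒ THE WEIGHTED CLASS-LEVEL SIZE BOUND `ChannelSize` OF §6** (triangle inequality over
the creation steps): the weighted form with creation-step-dependent majorants `N j` — the §6 input this seat had to READ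
into pp. 7–9 (cell GAPS row G-ne9p2-4) — is the printed step-sum structure plus the uniform-constant bound AT EACH STEP
SEPARATELY.  What remains a reading is only `ChannelSizeAtStep`: (1.36) for the step-j sub-sum with the pre-summation
constant of p. 8. [folklore] -/
theorem channelSize_of_perStep {Bg ι : Type} {Adm : Set (Bg → C.Dom → ℝ)}
    {T : ℕ → (ℕ → ℝ) → (Bg → C.Dom → ℝ) → ι → ℝ} {κ : ℝ} {wt : ℕ → ι → ℝ} {τ : ℕ → ℕ → ℝ}
    (hres : AdmRestrict Adm) (hsum : ChannelStepSum Adm T) (hstep : ChannelSizeAtStep Adm T κ wt τ) :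
    ChannelSize Adm T κ wt τ := by
  intro k s H hH N hN y
  rw [hsum k s H hH y, Finset.mul_sum]
  refine (Finset.abs_sum_le_sum_abs _ _).trans (Finset.sum_le_sum fun j hj => ?_)
  have hjk : j ≤ k := Nat.lt_succ_iff.mp (Finset.mem_range.mp hj)
  refine hstep k j hjk s (restrictScale j H) (hres.1 H hH j) (fun U X hX => restrictScale_of_ne H hX) (N j)
    (fun U X hX => ?_) y
  rw [restrictScale_of_eq H hX]
  simpa only [hX] using hN U X (by omega)

/-- SHAPE S-SIZE-U (the LITERALLY PRINTED TYPE of Lemma 1 — binder): ONE constant `τu`, the sum over the creation steps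
already performed: if ALL old terms created at the steps j ≤ k are bounded by the SAME `N·e^{−κd}` (N ≥ 0; print: E₀ of
(1.24)/(1.29)), the channel output is bounded by `wt k y · τu · N` — (1.36) p. 9 with p. 8 *"the sum over j is bounded by
2(6L)^4"*.  `τu` ↔ the O(1) of (1.36) in units of `wt`. [cite: Balaban1988RG2Cluster, (1.29) p.8, (1.36) p.9] -/
def ChannelSizeUniform {Bg ι : Type} (Adm : Set (Bg → C.Dom → ℝ))
    (T : ℕ → (ℕ → ℝ) → (Bg → C.Dom → ℝ) → ι → ℝ) (κ : ℝ) (wt : ℕ → ι → ℝ) (τu : ℝ) : Prop :=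
  ∀ (k : ℕ) (s : ℕ → ℝ), ∀ H ∈ Adm, ∀ N : ℝ, 0 ≤ N →
    (∀ (U : Bg) (X : C.Dom), C.scale X ≤ k → |H U X| ≤ Real.exp (-(κ * C.d X)) * N) →
      ∀ y : ι, |T k s H y| ≤ wt k y * (τu * N)

/-- The weighted form implies the uniform form with `τu ≥ Σ_{j≤k} τ k j` (nonnegative weights). [folklore] -/
theorem channelSizeUniform_of_weighted {Bg ι : Type} {Adm : Set (Bg → C.Dom → ℝ)}
    {T : ℕ → (ℕ → ℝ) → (Bg → C.Dom → ℝ) → ι → ℝ} {κ : ℝ} {wt : ℕ → ι → ℝ} {τ : ℕ → ℕ → ℝ} {τu : ℝ}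
    (hsize : ChannelSize Adm T κ wt τ) (hwt : ∀ k y, 0 ≤ wt k y) (hsumτ : ∀ k, ∑ j ∈ Finset.range (k + 1), τ k j ≤ τu) :
    ChannelSizeUniform Adm T κ wt τu := by
  intro k s H hH N hN0 hN y
  refine (hsize k s H hH (fun _ => N) (fun U X hX => hN U X hX) y).trans (mul_le_mul_of_nonneg_left ?_ (hwt k y))
  rw [← Finset.sum_mul]
  exact mul_le_mul_of_nonneg_right (hsumτ k) hN0

/-- Geometric per-step weights `0 ≤ τ k j ≤ τ̄ω^{k−j}` (0 ≤ ω < 1, τ̄ ≥ 0) sum to at most `τ̄/(1 − ω)`: the printed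
mechanism of p. 8–9 (*"the factor L^jη, which controls the sum over j"*, ω ↔ L^{−1}). [folklore] -/
theorem sum_geometricWeights_le {τ : ℕ → ℕ → ℝ} {τbar ω : ℝ} (hτbar : 0 ≤ τbar) (hω : 0 ≤ ω) (hω1 : ω < 1)
    (hτ : ∀ k j, j ≤ k → 0 ≤ τ k j ∧ τ k j ≤ τbar * ω ^ (k - j)) (k : ℕ) :
    ∑ j ∈ Finset.range (k + 1), τ k j ≤ τbar / (1 - ω) := by
  calc ∑ j ∈ Finset.range (k + 1), τ k j ≤ ∑ j ∈ Finset.range (k + 1), τbar * ω ^ (k - j) :=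
        Finset.sum_le_sum fun j hj => (hτ k j (Nat.lt_succ_iff.mp (Finset.mem_range.mp hj))).2
    _ = τbar * ∑ j ∈ Finset.range (k + 1), ω ^ j := by
        rw [Finset.mul_sum]
        have h := Finset.sum_range_reflect (fun j => τbar * ω ^ j) (k + 1)
        simpa only [Nat.add_sub_cancel] using h
    _ ≤ τbar * (1 / (1 - ω)) := by
        refine mul_le_mul_of_nonneg_left ?_ hτbar
        have h := geom_sum_Ico_le_of_lt_one (m := 0) (n := k + 1) hω hω1
        simpa only [Finset.range_eq_Ico, pow_zero] using h
    _ = τbar / (1 - ω) := by rw [mul_one_div]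

/-- Hence geometric weighted size ⇒ uniform size with `τu = τ̄/(1 − ω)`. [folklore] -/
theorem channelSizeUniform_of_geometric {Bg ι : Type} {Adm : Set (Bg → C.Dom → ℝ)}
    {T : ℕ → (ℕ → ℝ) → (Bg → C.Dom → ℝ) → ι → ℝ} {κ : ℝ} {wt : ℕ → ι → ℝ} {τ : ℕ → ℕ → ℝ} {τbar ω : ℝ}
    (hsize : ChannelSize Adm T κ wt τ) (hwt : ∀ k y, 0 ≤ wt k y) (hτbar : 0 ≤ τbar) (hω : 0 ≤ ω) (hω1 : ω < 1)
    (hτ : ∀ k j, j ≤ k → 0 ≤ τ k j ∧ τ k j ≤ τbar * ω ^ (k - j)) :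
    ChannelSizeUniform Adm T κ wt (τbar / (1 - ω)) :=
  channelSizeUniform_of_weighted hsize hwt (sum_geometricWeights_le hτbar hω hω1 hτ)

/-- The UNIFORM-RATE MAJORANT `Σ_{i<k} ℓρ^{k−1−i}|g_i − g′_i|` of the coupling-history differences seen by a term created
at step k (the NE9 right-hand side for the constant-rate product moduli, `geomMajorant_eq_prodModuli`). [folklore] -/
def geomMajorant (ℓ ρ : ℝ) (g g' : ℕ → ℝ) (k : ℕ) : ℝ :=
  ∑ i ∈ Finset.range k, ℓ * ρ ^ (k - 1 - i) * |g i - g' i|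

/-- Nonnegativity of the uniform-rate majorant (ℓ, ρ ≥ 0). [folklore] -/
theorem geomMajorant_nonneg {ℓ ρ : ℝ} (hℓ : 0 ≤ ℓ) (hρ : 0 ≤ ρ) (g g' : ℕ → ℝ) (k : ℕ) :
    0 ≤ geomMajorant ℓ ρ g g' k :=
  Finset.sum_nonneg fun _ _ => mul_nonneg (mul_nonneg hℓ (pow_nonneg hρ _)) (abs_nonneg _)

/-- For a rate `ρ ≥ 1` the majorant is MONOTONE in the creation step: every older difference seen at step j ≤ k is seen at
step k with at least the same weight.  (For ρ < 1 this fails — the content of `sticky_not_fadingMemory`.) [folklore] -/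
theorem geomMajorant_mono {ℓ ρ : ℝ} (hℓ : 0 ≤ ℓ) (hρ : 1 ≤ ρ) (g g' : ℕ → ℝ) {j k : ℕ} (hjk : j ≤ k) :
    geomMajorant ℓ ρ g g' j ≤ geomMajorant ℓ ρ g g' k := by
  have hρ0 : 0 ≤ ρ := zero_le_one.trans hρ
  calc geomMajorant ℓ ρ g g' j ≤ ∑ i ∈ Finset.range j, ℓ * ρ ^ (k - 1 - i) * |g i - g' i| :=
        Finset.sum_le_sum fun i hi => mul_le_mul_of_nonneg_right
          (mul_le_mul_of_nonneg_left (pow_le_pow_right₀ hρ (by omega)) hℓ) (abs_nonneg _)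
    _ ≤ geomMajorant ℓ ρ g g' k :=
        Finset.sum_le_sum_of_subset_of_nonneg (Finset.range_mono hjk) fun _ _ _ =>
          mul_nonneg (mul_nonneg hℓ (pow_nonneg hρ0 _)) (abs_nonneg _)

/-- One more step: `geomMajorant (k+1) = ℓ|g_k − g′_k| + ρ·geomMajorant k`. [folklore] -/
theorem geomMajorant_succ (ℓ ρ : ℝ) (g g' : ℕ → ℝ) (k : ℕ) :
    geomMajorant ℓ ρ g g' (k + 1) = ℓ * |g k - g' k| + ρ * geomMajorant ℓ ρ g g' k := by
  unfold geomMajorant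
  rw [Finset.sum_range_succ, Finset.mul_sum]
  have e0 : k + 1 - 1 - k = 0 := by omega
  rw [e0, pow_zero, mul_one, add_comm]
  congr 1
  refine Finset.sum_congr rfl fun i hi => ?_
  rw [Finset.mem_range] at hi
  have e : k + 1 - 1 - i = k - 1 - i + 1 := by omega
  rw [e, pow_succ]
  ring

/-- The majorant IS the NE9 right-hand side for the constant-rate product moduli. [folklore] -/
theorem geomMajorant_eq_prodModuli (ℓ ρ : ℝ) (g g' : ℕ → ℝ) (k : ℕ) :
    geomMajorant ℓ ρ g g' k = ∑ i ∈ Finset.range k, prodModuli ℓ (fun _ => ρ) k i * |g i - g' i| := by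
  refine Finset.sum_congr rfl fun i hi => ?_
  rw [prodModuli_const, if_pos (Finset.mem_range.mp hi)]

/-- **NE9 FROM THE UNIFORM (PRINTED-TYPE) SIZE BOUND — WITHOUT FADING.**  `ScaleZeroFree`, `AdmissibleTerms`,
`ChannelAdditive`, the UNIFORM size bound `ChannelSizeUniform … τu` and `OuterLipschitz … lam cΦ` with `lam k ≤ ℓ`,
`0 ≤ cΦ k ≤ c̄` give `T4OutputRate.NE9` with the moduli `ℓ·max(1, K)^{k−1−i}`, where `K := c̄·τu` is the Lipschitz
constant of the one-step map {old terms} ↦ {new term} with BOTH sides measured in the uniform decay norm `sup e^{κd}|·|`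
(invariant under rescaling `wt`): BOUNDED moduli (`≤ ℓ`) iff `K ≤ 1`, growing like `K^{age}` otherwise — and NO decay in
the age at this resolution (`sticky_not_fadingMemory`: a recursion satisfying every hypothesis here with K < 1 whose memory
of g₀ never fades).  Strong induction on the creation step with the uniform majorant `geomMajorant ℓ (max 1 K)`, which is
monotone in the step (`geomMajorant_mono`) — the one place where `ρ ≥ 1` is forced. [folklore] -/
theorem ne9_of_uniformChannel {Bg ι : Type} {E : Functional C Bg} {W : Set (ℕ → ℝ)}
    {Adm : Set (Bg → C.Dom → ℝ)} {T : ℕ → (ℕ → ℝ) → (Bg → C.Dom → ℝ) → ι → ℝ} {κ : ℝ} {wt : ℕ → ι → ℝ}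
    {τu : ℝ} {lam cΦ : ℕ → ℝ} {ℓ cbar : ℝ} (h0 : ScaleZeroFree E W) (hAdm : AdmissibleTerms E W Adm)
    (hadd : ChannelAdditive Adm T) (hsize : ChannelSizeUniform Adm T κ wt τu)
    (hout : OuterLipschitz E W T κ wt lam cΦ) (hℓ : 0 ≤ ℓ) (hτu : 0 ≤ τu) (hlam : ∀ k, lam k ≤ ℓ)
    (hcΦ : ∀ k, 0 ≤ cΦ k ∧ cΦ k ≤ cbar) :
    NE9 E W κ (prodModuli ℓ fun _ => max 1 (cbar * τu)) := by
  have hρ1 : 1 ≤ max 1 (cbar * τu) := le_max_left _ _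
  have hρ0 : 0 ≤ max 1 (cbar * τu) := zero_le_one.trans hρ1
  have hKρ : cbar * τu ≤ max 1 (cbar * τu) := le_max_right _ _
  suffices H : ∀ n, ∀ g ∈ W, ∀ g' ∈ W, ∀ (U : Bg) (X : C.Dom), C.scale X ≤ n →
      |E g U X - E g' U X| ≤ Real.exp (-(κ * C.d X)) * geomMajorant ℓ (max 1 (cbar * τu)) g g' (C.scale X) by
    intro g hg g' hg' U X
    rw [← geomMajorant_eq_prodModuli]
    exact H _ g hg g' hg' U X le_rfl
  intro n
  induction n with
  | zero =>
    intro g hg g' hg' U X hX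
    have hX0 : C.scale X = 0 := Nat.le_zero.mp hX
    rw [h0 g hg g' hg' U X hX0, sub_self, abs_zero]
    exact mul_nonneg (Real.exp_pos _).le (geomMajorant_nonneg hℓ hρ0 g g' _)
  | succ n ih =>
    intro g hg g' hg' U X hX
    rcases Nat.lt_or_ge (C.scale X) (n + 1) with hlt | hge
    · exact ih g hg g' hg' U X (Nat.lt_succ_iff.mp hlt)
    · have hk : C.scale X = n + 1 := le_antisymm hX hge
      -- the UNIFORM majorant of all old differences (monotonicity in the creation step)
      have hold : ∀ (U' : Bg) (X' : C.Dom), C.scale X' ≤ n →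
          |(E g - E g') U' X'| ≤ Real.exp (-(κ * C.d X')) * geomMajorant ℓ (max 1 (cbar * τu)) g g' n := by
        intro U' X' h'
        simpa only [Pi.sub_apply] using (ih g hg g' hg' U' X' h').trans
          (mul_le_mul_of_nonneg_left (geomMajorant_mono hℓ hρ1 g g' h') (Real.exp_pos _).le)
      have hch : ∀ y : ι, |T n g' (E g) y - T n g' (E g') y| ≤
          wt n y * (τu * geomMajorant ℓ (max 1 (cbar * τu)) g g' n) := by
        intro y
        rw [← hadd n g' (E g) (hAdm.1 g hg) (E g') (hAdm.1 g' hg') y]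
        exact hsize n g' (E g - E g') (hAdm.2 _ (hAdm.1 g hg) _ (hAdm.1 g' hg')) _
          (geomMajorant_nonneg hℓ hρ0 g g' n) hold y
      have hstep := hout g hg g' hg' n _ hch U X hk
      rw [hk, geomMajorant_succ]
      refine hstep.trans (mul_le_mul_of_nonneg_left ?_ (Real.exp_pos _).le)
      have hM0 := geomMajorant_nonneg hℓ hρ0 g g' n
      have h1 : lam n * |g n - g' n| ≤ ℓ * |g n - g' n| := mul_le_mul_of_nonneg_right (hlam n) (abs_nonneg _)
      have h2 : cΦ n * (τu * geomMajorant ℓ (max 1 (cbar * τu)) g g' n) ≤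
          max 1 (cbar * τu) * geomMajorant ℓ (max 1 (cbar * τu)) g g' n := by
        rw [← mul_assoc]
        exact mul_le_mul_of_nonneg_right ((mul_le_mul_of_nonneg_right (hcΦ n).2 hτu).trans hKρ) hM0
      linarith

/-- With bounded moduli (`K = c̄τu ≤ 1`): the influence of ANY single coupling on ANY later term is at most `ℓ`, uniformly
in the age — NE9 with `Λ k i = ℓ` for `i < k`. [folklore] -/
theorem ne9_bounded_of_uniformChannel {Bg ι : Type} {E : Functional C Bg} {W : Set (ℕ → ℝ)}
    {Adm : Set (Bg → C.Dom → ℝ)} {T : ℕ → (ℕ → ℝ) → (Bg → C.Dom → ℝ) → ι → ℝ} {κ : ℝ} {wt : ℕ → ι → ℝ}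
    {τu : ℝ} {lam cΦ : ℕ → ℝ} {ℓ cbar : ℝ} (h0 : ScaleZeroFree E W) (hAdm : AdmissibleTerms E W Adm)
    (hadd : ChannelAdditive Adm T) (hsize : ChannelSizeUniform Adm T κ wt τu)
    (hout : OuterLipschitz E W T κ wt lam cΦ) (hℓ : 0 ≤ ℓ) (hτu : 0 ≤ τu) (hlam : ∀ k, lam k ≤ ℓ)
    (hcΦ : ∀ k, 0 ≤ cΦ k ∧ cΦ k ≤ cbar) (hK : cbar * τu ≤ 1) :
    NE9 E W κ (prodModuli ℓ fun _ => 1) := by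
  have h := ne9_of_uniformChannel h0 hAdm hadd hsize hout hℓ hτu hlam hcΦ
  rwa [max_eq_left hK] at h

/-- IDENTIFICATION OF THE SMALLNESS (pure algebra): for `ω < 1`, the NE9-FADE condition of §6, `ω + c̄τ̄ < 1`, IS the
strict-contraction condition `K∞ := c̄τ̄/(1 − ω) < 1` of the one-step map {old-term differences} ↦ {new-term difference} in
the uniform decay norm (`K∞ ≥ K = c̄τu` by `sum_geometricWeights_le`); the memory rate is `ω + c̄τ̄ = 1 − (1 − ω)(1 − K∞)`
(`fadeRate_eq`).  So the cell's unprinted hypothesis NE9-FADE (GAPS G-ne9p2-3) reads: the RG step CONTRACTS differences of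
old irrelevant terms in the uniform decay norm — and the per-step weights `L^{−(k−j)}` of p. 8–9 decide between "bounded"
(§7, uniform form) and "fading" (§6, weighted form). [folklore] -/
theorem fade_iff_contraction {ω cbar τbar : ℝ} (hω1 : ω < 1) :
    ω + cbar * τbar < 1 ↔ cbar * τbar / (1 - ω) < 1 := by
  rw [div_lt_one (sub_pos.mpr hω1)]
  constructor <;> intro h <;> linarith

/-- The memory rate in terms of the contraction constant: `ω + c̄τ̄ = 1 − (1 − ω)(1 − K∞)`, `K∞ = c̄τ̄/(1 − ω)`. [folklore] -/
theorem fadeRate_eq {ω cbar τbar : ℝ} (hω1 : ω < 1) :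
    ω + cbar * τbar = 1 - (1 - ω) * (1 - cbar * τbar / (1 - ω)) := by
  have h : (1 - ω) ≠ 0 := (sub_pos.mpr hω1).ne'
  field_simp
  ring

/-! ### §7b The toy recursion through the per-step bounds, and the STICKY recursion: uniform bounds with K < 1, NE9 with
bounded moduli, and provably NO fading memory -/

/-- The toy recursion of §5 satisfies the per-step hypotheses: restriction/truncation-closed class (all functionals), the
step-sum structure, and `ChannelSizeAtStep` with `wt ≡ 1`, `τ k j = [j = k]`. [folklore] -/
theorem toy_perStep :
    AdmRestrict (C := toyCarriers) (Bg := Unit) Set.univ ∧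
      ChannelStepSum (C := toyCarriers) Set.univ toyChannel ∧
      ChannelSizeAtStep (C := toyCarriers) Set.univ toyChannel 0 (fun _ _ => 1)
        (fun k j => if j = k then 1 else 0) := by
  refine ⟨⟨fun _ _ _ => Set.mem_univ _, fun _ _ _ => Set.mem_univ _⟩, ?_, ?_⟩
  · intro k s H _ y
    obtain ⟨⟩ := y
    show H () k = ∑ j ∈ Finset.range (k + 1), (if (k : ℕ) = j then H () k else 0)
    rw [Finset.sum_ite_eq, if_pos (Finset.mem_range.mpr (Nat.lt_succ_self k))]
  · intro k j hjk s H _ hsupp N hN y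
    obtain ⟨⟩ := y
    show |H () k| ≤ 1 * ((if j = k then (1 : ℝ) else 0) * N)
    by_cases h : j = k
    · subst h
      simpa using hN () j rfl
    · have hk : H () k = 0 := hsupp () k (fun hkj => h hkj.symm)
      simp [hk, h]

/-- §7 reproduces the §6 size bound of the toy recursion from its per-step bounds. [folklore] -/
theorem toy_channelSize_of_perStep :
    ChannelSize (C := toyCarriers) Set.univ toyChannel 0 (fun _ _ => 1) (fun k j => if j = k then 1 else 0) :=
  channelSize_of_perStep toy_perStep.1 toy_perStep.2.1 toy_perStep.2.2

/-- THE STICKY RECURSION `E_0 = 0`, `E_1 = g_0`, `E_{k+2} = g_{k+1} + K·g_0`: the new term reads the last coupling and — with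
the fixed factor K — the term created at step 1, however old. [folklore] -/
def stickyE (K : ℝ) : Functional toyCarriers Unit :=
  fun g _ (k : ℕ) => match k with
    | 0 => 0
    | 1 => g 0
    | k + 2 => g (k + 1) + K * g 0

/-- No term at step 0. [folklore] -/
@[simp] theorem stickyE_zero (K : ℝ) (g : ℕ → ℝ) (u : Unit) : stickyE K g u 0 = 0 := rfl

/-- The step-1 term is the first coupling. [folklore] -/
@[simp] theorem stickyE_one (K : ℝ) (g : ℕ → ℝ) (u : Unit) : stickyE K g u 1 = g 0 := rfl

/-- The sticky step: last coupling plus K times the step-1 term. [folklore] -/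
@[simp] theorem stickyE_add_two (K : ℝ) (g : ℕ → ℝ) (u : Unit) (k : ℕ) :
    stickyE K g u (k + 2) = g (k + 1) + K * g 0 := rfl

/-- The sticky channel: at step k it outputs the term created at step `min k 1` (the step-1 term from k = 1 on). [folklore] -/
def stickyChannel : ℕ → (ℕ → ℝ) → (Unit → ℕ → ℝ) → Unit → ℝ := fun k _ H _ => H () (min k 1)

/-- The sticky recursion satisfies EVERY hypothesis of `ne9_of_uniformChannel` with `wt ≡ 1`, `τu = 1`, `lam ≡ 1`,
`cΦ ≡ K` (κ = 0, any window): in particular the UNIFORM size bound — the channel output is ONE old term. [folklore] -/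
theorem sticky_uniformChannel {K : ℝ} (hK : 0 ≤ K) (W : Set (ℕ → ℝ)) :
    ScaleZeroFree (C := toyCarriers) (stickyE K) W ∧
      AdmissibleTerms (C := toyCarriers) (stickyE K) W Set.univ ∧
      ChannelAdditive (C := toyCarriers) Set.univ stickyChannel ∧
      ChannelSizeUniform (C := toyCarriers) Set.univ stickyChannel 0 (fun _ _ => 1) 1 ∧
      OuterLipschitz (C := toyCarriers) (stickyE K) W stickyChannel 0 (fun _ _ => 1) (fun _ => 1) (fun _ => K) := by
  refine ⟨?_, ⟨fun _ _ => Set.mem_univ _, fun _ _ _ _ => Set.mem_univ _⟩, fun _ _ _ _ _ _ _ => rfl, ?_, ?_⟩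
  · intro g _ g' _ u X hX
    change X = 0 at hX
    subst hX
    rfl
  · intro k s H _ N _ hN y
    obtain ⟨⟩ := y
    show |H () (min k 1)| ≤ 1 * (1 * N)
    simpa using hN () (min k 1) (Nat.min_le_left k 1)
  · intro g _ g' _ k M hM u X hX
    change X = k + 1 at hX
    subst hX
    obtain ⟨⟩ := u
    have hM' : |stickyE K g () (min k 1) - stickyE K g' () (min k 1)| ≤ M := by
      simpa [stickyChannel] using hM ()
    have hM0 : 0 ≤ M := (abs_nonneg _).trans hM'
    simp only [zero_mul, neg_zero, Real.exp_zero, one_mul]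
    rcases k with _ | m
    · simp only [stickyE_one, Nat.zero_add]
      nlinarith [abs_nonneg (g 0 - g' 0), mul_nonneg hK hM0]
    · have h1 : min (m + 1) 1 = 1 := Nat.min_eq_right (Nat.le_add_left 1 m)
      rw [h1, stickyE_one, stickyE_one] at hM'
      rw [show m + 1 + 1 = m + 2 from rfl, stickyE_add_two, stickyE_add_two]
      calc |g (m + 1) + K * g 0 - (g' (m + 1) + K * g' 0)|
          = |(g (m + 1) - g' (m + 1)) + K * (g 0 - g' 0)| := by ring_nf
        _ ≤ |g (m + 1) - g' (m + 1)| + |K * (g 0 - g' 0)| := abs_add_le _ _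
        _ = |g (m + 1) - g' (m + 1)| + K * |g 0 - g' 0| := by rw [abs_mul, abs_of_nonneg hK]
        _ ≤ |g (m + 1) - g' (m + 1)| + K * M := by nlinarith [mul_le_mul_of_nonneg_left hM' hK]

/-- NE9 for the sticky recursion from §7: moduli `max(1, K)^{k−1−i}` — BOUNDED BY 1 when `K ≤ 1`. [folklore] -/
theorem sticky_ne9 {K : ℝ} (hK : 0 ≤ K) (W : Set (ℕ → ℝ)) :
    NE9 (C := toyCarriers) (stickyE K) W 0 (prodModuli 1 fun _ => max 1 (K * 1)) := by
  obtain ⟨h0, hAdm, hadd, hsize, hout⟩ := sticky_uniformChannel hK W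
  exact ne9_of_uniformChannel (cbar := K) h0 hAdm hadd hsize hout zero_le_one zero_le_one (fun _ => le_rfl)
    fun _ => ⟨hK, le_rfl⟩

/-- THE MEMORY OF g₀ NEVER FADES: any NE9 moduli family of the sticky recursion (full window) has `Λ (k+2) 0 ≥ |K|` at EVERY
age — compare the histories `[1, 0, 0, …]` and `0`. [folklore] -/
theorem sticky_memory_lower {K : ℝ} {Λ : ℕ → ℕ → ℝ} (h : NE9 (C := toyCarriers) (stickyE K) Set.univ 0 Λ) (k : ℕ) :
    |K| ≤ Λ (k + 2) 0 := by
  have h1 : |stickyE K (fun i => if i = 0 then (1 : ℝ) else 0) () (k + 2) - stickyE K (fun _ => 0) () (k + 2)| ≤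
      Real.exp (-(0 * (0 : ℝ))) * ∑ i ∈ Finset.range (k + 2),
        Λ (k + 2) i * |(fun i => if i = 0 then (1 : ℝ) else 0) i - (fun _ => (0 : ℝ)) i| :=
    h (fun i => if i = 0 then (1 : ℝ) else 0) (Set.mem_univ _) (fun _ => 0) (Set.mem_univ _) () (k + 2)
  have hL : stickyE K (fun i => if i = 0 then (1 : ℝ) else 0) () (k + 2) - stickyE K (fun _ => 0) () (k + 2) = K := by
    rw [stickyE_add_two, stickyE_add_two]
    simp
  have hR : ∑ i ∈ Finset.range (k + 2),
      Λ (k + 2) i * |(fun i => if i = 0 then (1 : ℝ) else 0) i - (fun _ => (0 : ℝ)) i| = Λ (k + 2) 0 := by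
    rw [Finset.sum_eq_single 0 (fun i _ hi => by simp [hi]) (fun h0 => absurd (by simp) h0)]
    simp
  rw [hL, hR] at h1
  simpa using h1

/-- **NO FADING MEMORY FROM THE UNIFORM FORM** (kernel certificate of the §7 dichotomy): for `K > 0` — in particular for
every `0 < K < 1`, where ALL hypotheses of `ne9_of_uniformChannel` hold with a STRICT contraction and NE9 holds with moduli
bounded by 1 — NO family of NE9 moduli of the sticky recursion has `T4OutputRate.FadingMemory C₉ ω` with a rate `ω < 1`.
So the UNIFORM hypothesis set of §7 is INSUFFICIENT for NE9-FADE — some age-sensitive input is needed; the creation-step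
weights of `ChannelSize` (§6; p. 8–9 of [Balaban1988RG2Cluster], one factor `L^{−1}` per step of age) are the sufficient
one this module uses, not a convenience of the reading («necessary» in that sense only). [folklore] -/
theorem sticky_not_fadingMemory {K C₉ ω : ℝ} (hK : 0 < K) {Λ : ℕ → ℕ → ℝ}
    (h : NE9 (C := toyCarriers) (stickyE K) Set.univ 0 Λ) (hω1 : ω < 1) : ¬ FadingMemory C₉ ω Λ := by
  intro hF
  have hlow : ∀ k, K ≤ C₉ * ω ^ (k + 2) := fun k =>
    ((le_abs_self K).trans (sticky_memory_lower h k)).trans (by simpa using (hF (k + 2) 0 (Nat.zero_le _)).2)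
  have h2 : K ≤ C₉ * ω ^ 2 := by simpa using hlow 0
  have hC : 0 < C₉ := by
    by_contra hC
    push Not at hC
    nlinarith [mul_nonneg (neg_nonneg.mpr hC) (sq_nonneg ω)]
  have hω0 : 0 ≤ ω := by
    by_contra hneg
    push Not at hneg
    have h10 : 0 ≤ Λ 1 0 ∧ Λ 1 0 ≤ C₉ * ω := by simpa using hF 1 0 (by norm_num)
    nlinarith [mul_pos hC (neg_pos.mpr hneg)]
  obtain ⟨n, hn⟩ := exists_pow_lt_of_lt_one (div_pos hK hC) hω1
  have hle : ω ^ (n + 2) ≤ ω ^ n := pow_le_pow_of_le_one hω0 hω1.le (by omega)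
  have hlt : C₉ * ω ^ n < K := by
    calc C₉ * ω ^ n < C₉ * (K / C₉) := mul_lt_mul_of_pos_left hn hC
      _ = K := by field_simp
  have := hlow n
  nlinarith [mul_le_mul_of_nonneg_left hle hC.le]

/-! ## §8 (v1.3) Sign-guarded binders: the majorant constants quantified over NONNEGATIVE reals only (cell XREAD
C-pv15g8-4 remark R5); every consumer re-derived; the unguarded forms of §1/§6/§7 recovered under the instantiation-side
cure (weight zero at uninhabited creation steps) -/

/-- SHAPE S-STEP⁺ (guarded form of `StepLipschitz` — binder): the one-step inequality asked only for NONNEGATIVE old-term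
difference majorants `D j ≥ 0` (a majorant of an absolute value at an inhabited step is ≥ 0 anyway; at an uninhabited step
the unguarded `∀ D` lets `D j → −∞`).  Weaker than `StepLipschitz` (`stepLipschitzNN_of_stepLipschitz`) and still sufficient
for NE9 with nonnegative moduli (`ne9_of_stepLipschitzNN`). [cite: Balaban1987RG1, (2.12)-(2.13) p.268 and §3 p.270] -/
def StepLipschitzNN {Bg : Type} (E : Functional C Bg) (W : Set (ℕ → ℝ)) (κ : ℝ) (lam : ℕ → ℝ)
    (a : ℕ → ℕ → ℝ) : Prop :=
  ∀ g ∈ W, ∀ g' ∈ W, ∀ (D : ℕ → ℝ) (k : ℕ), (∀ j, 0 ≤ D j) →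
    (∀ (U' : Bg) (X' : C.Dom), C.scale X' ≤ k →
        |E g U' X' - E g' U' X'| ≤ Real.exp (-(κ * C.d X')) * D (C.scale X')) →
      ∀ (U : Bg) (X : C.Dom), C.scale X = k + 1 →
        |E g U X - E g' U X| ≤
          Real.exp (-(κ * C.d X)) * (lam k * |g k - g' k| + ∑ j ∈ Finset.range (k + 1), a k j * D j)

/-- The unguarded step inequality implies the guarded one (drop the sign hypothesis). [folklore] -/
theorem stepLipschitzNN_of_stepLipschitz {Bg : Type} {E : Functional C Bg} {W : Set (ℕ → ℝ)} {κ : ℝ}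
    {lam : ℕ → ℝ} {a : ℕ → ℕ → ℝ} (hS : StepLipschitz E W κ lam a) : StepLipschitzNN E W κ lam a :=
  fun g hg g' hg' D k _ hD U X hX => hS g hg g' hg' D k hD U X hX

/-- **NE9 FROM THE GUARDED STEP INEQUALITY** (§2 re-run): `ScaleZeroFree`, `StepLipschitzNN E W κ lam a` and a NONNEGATIVE
super-solution `Λ ≥ 0` of the renewal inequalities give `T4OutputRate.NE9 E W κ Λ`, for any window — the induction
majorant `D j = Σ_{i<j} Λ j i·|g_i − g′_i|` is ≥ 0, so the guard is met at every step. [folklore] -/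
theorem ne9_of_stepLipschitzNN {Bg : Type} {E : Functional C Bg} {W : Set (ℕ → ℝ)} {κ : ℝ} {lam : ℕ → ℝ}
    {a Λ : ℕ → ℕ → ℝ} (h0 : ScaleZeroFree E W) (hS : StepLipschitzNN E W κ lam a)
    (hΛ : RenewalSuper lam a Λ) (hΛ0 : ∀ k i, 0 ≤ Λ k i) : NE9 E W κ Λ := by
  suffices H : ∀ n, ∀ g ∈ W, ∀ g' ∈ W, ∀ (U : Bg) (X : C.Dom), C.scale X ≤ n →
      |E g U X - E g' U X| ≤
        Real.exp (-(κ * C.d X)) * ∑ i ∈ Finset.range (C.scale X), Λ (C.scale X) i * |g i - g' i| from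
    fun g hg g' hg' U X => H _ g hg g' hg' U X le_rfl
  intro n
  induction n with
  | zero =>
    intro g hg g' hg' U X hX
    have hX0 : C.scale X = 0 := Nat.le_zero.mp hX
    simp [h0 g hg g' hg' U X hX0, hX0]
  | succ n ih =>
    intro g hg g' hg' U X hX
    rcases Nat.lt_or_ge (C.scale X) (n + 1) with hlt | hge
    · exact ih g hg g' hg' U X (Nat.lt_succ_iff.mp hlt)
    · have hk : C.scale X = n + 1 := le_antisymm hX hge
      have hstep := hS g hg g' hg' (fun j => ∑ i ∈ Finset.range j, Λ j i * |g i - g' i|) n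
        (fun j => Finset.sum_nonneg fun i _ => mul_nonneg (hΛ0 j i) (abs_nonneg _))
        (fun U' X' h' => ih g hg g' hg' U' X' h') U X hk
      rw [hk]
      refine hstep.trans (mul_le_mul_of_nonneg_left ?_ (Real.exp_pos _).le)
      exact renewal_coeff_le hΛ n (δ := fun i => |g i - g' i|) fun i => abs_nonneg _

/-- **GUARDED HEADLINE OF §4**: `ScaleZeroFree`, `StepLipschitzNN E W κ lam a` with `lam k ≤ ℓ`, `a k j ≤ c·ω^{k−j}`
(ℓ, c, ω ≥ 0, ω + c > 0) give `NE9 E W κ Λ ∧ FadingMemory (ℓ/(ω+c)) (ω+c) Λ` with `Λ k i = ℓ(ω+c)^{k−1−i}` (≥ 0,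
`prodModuli_nonneg`). [folklore] -/
theorem ne9_and_fadingMemory_of_geometricStepNN {Bg : Type} {E : Functional C Bg} {W : Set (ℕ → ℝ)}
    {κ ℓ c ω : ℝ} {lam : ℕ → ℝ} {a : ℕ → ℕ → ℝ} (h0 : ScaleZeroFree E W) (hS : StepLipschitzNN E W κ lam a)
    (hℓ : 0 ≤ ℓ) (hc : 0 ≤ c) (hω : 0 ≤ ω) (hpos : 0 < ω + c) (hlam : ∀ k, lam k ≤ ℓ)
    (ha : ∀ k j, j ≤ k → a k j ≤ c * ω ^ (k - j)) :
    NE9 E W κ (prodModuli ℓ fun _ => ω + c) ∧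
      FadingMemory (ℓ / (ω + c)) (ω + c) (prodModuli ℓ fun _ => ω + c) :=
  ⟨ne9_of_stepLipschitzNN h0 hS (renewalSuper_geometric hℓ hc hω hlam ha)
      (prodModuli_nonneg hℓ fun _ => hpos.le),
    fadingMemory_geometric hℓ hpos⟩

/-- SHAPE S-SIZE⁺ (guarded form of the weighted class-level size bound `ChannelSize` of §6 — binder): the creation-step
majorants `N j` range over NONNEGATIVE reals only. [cite: Balaban1988RG2Cluster, (1.24) p.7, (1.29) p.8, (1.36) p.9] -/
def ChannelSizeNN {Bg ι : Type} (Adm : Set (Bg → C.Dom → ℝ)) (T : ℕ → (ℕ → ℝ) → (Bg → C.Dom → ℝ) → ι → ℝ)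
    (κ : ℝ) (wt : ℕ → ι → ℝ) (τ : ℕ → ℕ → ℝ) : Prop :=
  ∀ (k : ℕ) (s : ℕ → ℝ), ∀ H ∈ Adm, ∀ (N : ℕ → ℝ), (∀ j, 0 ≤ N j) →
    (∀ (U : Bg) (X : C.Dom), C.scale X ≤ k → |H U X| ≤ Real.exp (-(κ * C.d X)) * N (C.scale X)) →
      ∀ y : ι, |T k s H y| ≤ wt k y * ∑ j ∈ Finset.range (k + 1), τ k j * N j

/-- SHAPE S-SIZE-j⁺ (guarded form of the per-creation-step size bound `ChannelSizeAtStep` of §7 — binder): the step-j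
majorant `N` ranges over NONNEGATIVE reals only (print's E₀ of (1.24)/(1.29) p. 7–8 is a sup, hence ≥ 0).
[cite: Balaban1988RG2Cluster, (1.24) p.7, (1.29) p.8, p.8 l.9-10, (1.36) p.9] -/
def ChannelSizeAtStepNN {Bg ι : Type} (Adm : Set (Bg → C.Dom → ℝ))
    (T : ℕ → (ℕ → ℝ) → (Bg → C.Dom → ℝ) → ι → ℝ) (κ : ℝ) (wt : ℕ → ι → ℝ) (τ : ℕ → ℕ → ℝ) : Prop :=
  ∀ (k j : ℕ), j ≤ k → ∀ (s : ℕ → ℝ), ∀ H ∈ Adm,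
    (∀ (U : Bg) (X : C.Dom), C.scale X ≠ j → H U X = 0) →
      ∀ N : ℝ, 0 ≤ N → (∀ (U : Bg) (X : C.Dom), C.scale X = j → |H U X| ≤ Real.exp (-(κ * C.d X)) * N) →
        ∀ y : ι, |T k s H y| ≤ wt k y * (τ k j * N)

/-- Unguarded ⇒ guarded (weighted class-level form). [folklore] -/
theorem channelSizeNN_of_channelSize {Bg ι : Type} {Adm : Set (Bg → C.Dom → ℝ)}
    {T : ℕ → (ℕ → ℝ) → (Bg → C.Dom → ℝ) → ι → ℝ} {κ : ℝ} {wt : ℕ → ι → ℝ} {τ : ℕ → ℕ → ℝ}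
    (hsize : ChannelSize Adm T κ wt τ) : ChannelSizeNN Adm T κ wt τ :=
  fun k s H hH N _ hN y => hsize k s H hH N hN y

/-- Unguarded ⇒ guarded (per-creation-step form). [folklore] -/
theorem channelSizeAtStepNN_of_channelSizeAtStep {Bg ι : Type} {Adm : Set (Bg → C.Dom → ℝ)}
    {T : ℕ → (ℕ → ℝ) → (Bg → C.Dom → ℝ) → ι → ℝ} {κ : ℝ} {wt : ℕ → ι → ℝ} {τ : ℕ → ℕ → ℝ}
    (hstep : ChannelSizeAtStep Adm T κ wt τ) : ChannelSizeAtStepNN Adm T κ wt τ :=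
  fun k j hjk s H hH hsupp N _ hN y => hstep k j hjk s H hH hsupp N hN y

/-- **GUARDED PER-STEP SIZE BOUNDS + STEP-SUM ⇒ THE GUARDED WEIGHTED SIZE BOUND** (§7's `channelSize_of_perStep` re-run;
the sign `N j ≥ 0` passes through unchanged). [folklore] -/
theorem channelSizeNN_of_perStepNN {Bg ι : Type} {Adm : Set (Bg → C.Dom → ℝ)}
    {T : ℕ → (ℕ → ℝ) → (Bg → C.Dom → ℝ) → ι → ℝ} {κ : ℝ} {wt : ℕ → ι → ℝ} {τ : ℕ → ℕ → ℝ}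
    (hres : AdmRestrict Adm) (hsum : ChannelStepSum Adm T) (hstep : ChannelSizeAtStepNN Adm T κ wt τ) :
    ChannelSizeNN Adm T κ wt τ := by
  intro k s H hH N hN0 hN y
  rw [hsum k s H hH y, Finset.mul_sum]
  refine (Finset.abs_sum_le_sum_abs _ _).trans (Finset.sum_le_sum fun j hj => ?_)
  have hjk : j ≤ k := Nat.lt_succ_iff.mp (Finset.mem_range.mp hj)
  refine hstep k j hjk s (restrictScale j H) (hres.1 H hH j) (fun U X hX => restrictScale_of_ne H hX) (N j)
    (hN0 j) (fun U X hX => ?_) y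
  rw [restrictScale_of_eq H hX]
  simpa only [hX] using hN U X (by omega)

/-- The guarded weighted form already implies the (guarded, printed-type) uniform form `ChannelSizeUniform` of §7 with
`τu ≥ Σ_{j≤k} τ k j` (nonnegative weights). [folklore] -/
theorem channelSizeUniform_of_weightedNN {Bg ι : Type} {Adm : Set (Bg → C.Dom → ℝ)}
    {T : ℕ → (ℕ → ℝ) → (Bg → C.Dom → ℝ) → ι → ℝ} {κ : ℝ} {wt : ℕ → ι → ℝ} {τ : ℕ → ℕ → ℝ} {τu : ℝ}
    (hsize : ChannelSizeNN Adm T κ wt τ) (hwt : ∀ k y, 0 ≤ wt k y)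
    (hsumτ : ∀ k, ∑ j ∈ Finset.range (k + 1), τ k j ≤ τu) : ChannelSizeUniform Adm T κ wt τu := by
  intro k s H hH N hN0 hN y
  refine (hsize k s H hH (fun _ => N) (fun _ => hN0) (fun U X hX => hN U X hX) y).trans
    (mul_le_mul_of_nonneg_left ?_ (hwt k y))
  rw [← Finset.sum_mul]
  exact mul_le_mul_of_nonneg_right (hsumτ k) hN0

/-- Geometric per-step weights: the guarded weighted form gives `ChannelSizeUniform … (τ̄/(1 − ω))`. [folklore] -/
theorem channelSizeUniform_of_geometricNN {Bg ι : Type} {Adm : Set (Bg → C.Dom → ℝ)}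
    {T : ℕ → (ℕ → ℝ) → (Bg → C.Dom → ℝ) → ι → ℝ} {κ : ℝ} {wt : ℕ → ι → ℝ} {τ : ℕ → ℕ → ℝ} {τbar ω : ℝ}
    (hsize : ChannelSizeNN Adm T κ wt τ) (hwt : ∀ k y, 0 ≤ wt k y) (hτbar : 0 ≤ τbar) (hω : 0 ≤ ω) (hω1 : ω < 1)
    (hτ : ∀ k j, j ≤ k → 0 ≤ τ k j ∧ τ k j ≤ τbar * ω ^ (k - j)) :
    ChannelSizeUniform Adm T κ wt (τbar / (1 - ω)) :=
  channelSizeUniform_of_weightedNN hsize hwt (sum_geometricWeights_le hτbar hω hω1 hτ)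

/-- **ADDITIVITY + GUARDED SIZE ⇒ DIFFERENCE** for NONNEGATIVE difference majorants `D j ≥ 0` (§6's `channelDiff_of_size`
re-run). [folklore] -/
theorem channelDiffNN_of_size {Bg ι : Type} {Adm : Set (Bg → C.Dom → ℝ)}
    {T : ℕ → (ℕ → ℝ) → (Bg → C.Dom → ℝ) → ι → ℝ} {κ : ℝ} {wt : ℕ → ι → ℝ} {τ : ℕ → ℕ → ℝ}
    (hadd : ChannelAdditive Adm T) (hsize : ChannelSizeNN Adm T κ wt τ) {H₁ H₂ : Bg → C.Dom → ℝ} (h₁ : H₁ ∈ Adm)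
    (h₂ : H₂ ∈ Adm) (h₁₂ : H₁ - H₂ ∈ Adm) (k : ℕ) (s : ℕ → ℝ) {D : ℕ → ℝ} (hD0 : ∀ j, 0 ≤ D j)
    (hD : ∀ (U : Bg) (X : C.Dom), C.scale X ≤ k → |H₁ U X - H₂ U X| ≤ Real.exp (-(κ * C.d X)) * D (C.scale X))
    (y : ι) : |T k s H₁ y - T k s H₂ y| ≤ wt k y * ∑ j ∈ Finset.range (k + 1), τ k j * D j := by
  rw [← hadd k s H₁ h₁ H₂ h₂ y]
  exact hsize k s (H₁ - H₂) h₁₂ D hD0 (fun U X hX => by simpa only [Pi.sub_apply] using hD U X hX) y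

/-- **THE GUARDED STEP INEQUALITY FROM THE GUARDED LINEAR CHANNEL**: `AdmissibleTerms`, `ChannelAdditive`,
`ChannelSizeNN … κ wt τ` and `OuterLipschitz … κ wt lam cΦ` give `StepLipschitzNN E W κ lam (fun k j => cΦ k * τ k j)`.
[folklore] -/
theorem stepLipschitzNN_of_linearChannelNN {Bg ι : Type} {E : Functional C Bg} {W : Set (ℕ → ℝ)}
    {Adm : Set (Bg → C.Dom → ℝ)} {T : ℕ → (ℕ → ℝ) → (Bg → C.Dom → ℝ) → ι → ℝ} {κ : ℝ} {wt : ℕ → ι → ℝ}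
    {τ : ℕ → ℕ → ℝ} {lam cΦ : ℕ → ℝ} (hAdm : AdmissibleTerms E W Adm) (hadd : ChannelAdditive Adm T)
    (hsize : ChannelSizeNN Adm T κ wt τ) (hout : OuterLipschitz E W T κ wt lam cΦ) :
    StepLipschitzNN E W κ lam (fun k j => cΦ k * τ k j) := by
  intro g hg g' hg' D k hD0 hD U X hX
  have hM : ∀ y : ι, |T k g' (E g) y - T k g' (E g') y| ≤ wt k y * ∑ j ∈ Finset.range (k + 1), τ k j * D j :=
    channelDiffNN_of_size hadd hsize (hAdm.1 g hg) (hAdm.1 g' hg') (hAdm.2 _ (hAdm.1 g hg) _ (hAdm.1 g' hg')) k g'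
      hD0 hD
  have h := hout g hg g' hg' k _ hM U X hX
  simpa only [Finset.mul_sum, mul_assoc] using h

/-- **GUARDED HEADLINE OF §6 — NE9 ∧ FADING MEMORY FROM THE GUARDED LINEAR CHANNEL**: as
`ne9_and_fadingMemory_of_linearChannel`, with `ChannelSizeNN` in place of `ChannelSize`; same moduli
`ℓ(ω + c̄τ̄)^{k−1−i}`, same rate. [folklore] -/
theorem ne9_and_fadingMemory_of_linearChannelNN {Bg ι : Type} {E : Functional C Bg} {W : Set (ℕ → ℝ)}
    {Adm : Set (Bg → C.Dom → ℝ)} {T : ℕ → (ℕ → ℝ) → (Bg → C.Dom → ℝ) → ι → ℝ} {κ : ℝ} {wt : ℕ → ι → ℝ}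
    {τ : ℕ → ℕ → ℝ} {lam cΦ : ℕ → ℝ} {ℓ cbar τbar ω : ℝ} (h0 : ScaleZeroFree E W)
    (hAdm : AdmissibleTerms E W Adm) (hadd : ChannelAdditive Adm T) (hsize : ChannelSizeNN Adm T κ wt τ)
    (hout : OuterLipschitz E W T κ wt lam cΦ) (hℓ : 0 ≤ ℓ) (hc : 0 ≤ cbar) (hτbar : 0 ≤ τbar) (hω : 0 ≤ ω)
    (hpos : 0 < ω + cbar * τbar) (hlam : ∀ k, lam k ≤ ℓ) (hcΦ : ∀ k, 0 ≤ cΦ k ∧ cΦ k ≤ cbar)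
    (hτ : ∀ k j, j ≤ k → 0 ≤ τ k j ∧ τ k j ≤ τbar * ω ^ (k - j)) :
    NE9 E W κ (prodModuli ℓ fun _ => ω + cbar * τbar) ∧
      FadingMemory (ℓ / (ω + cbar * τbar)) (ω + cbar * τbar) (prodModuli ℓ fun _ => ω + cbar * τbar) :=
  ne9_and_fadingMemory_of_geometricStepNN h0 (stepLipschitzNN_of_linearChannelNN hAdm hadd hsize hout) hℓ
    (mul_nonneg hc hτbar) hω hpos hlam fun k j hjk => by
      show cΦ k * τ k j ≤ cbar * τbar * ω ^ (k - j)
      calc cΦ k * τ k j ≤ cbar * (τbar * ω ^ (k - j)) := mul_le_mul (hcΦ k).2 (hτ k j hjk).2 (hτ k j hjk).1 hc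
        _ = cbar * τbar * ω ^ (k - j) := (mul_assoc _ _ _).symm

/-- **END TO END, GUARDED** (§7 ∘ §6 ∘ §4 with signs): restriction-closed admissible class, step-sum structure, the
GUARDED per-creation-step size bounds with geometric weights `0 ≤ τ k j ≤ τ̄ω^{k−j}`, and `OuterLipschitz` give
`NE9 ∧ FadingMemory` with the moduli `ℓ(ω + c̄τ̄)^{k−1−i}`. [folklore] -/
theorem ne9_and_fadingMemory_of_perStepNN {Bg ι : Type} {E : Functional C Bg} {W : Set (ℕ → ℝ)}
    {Adm : Set (Bg → C.Dom → ℝ)} {T : ℕ → (ℕ → ℝ) → (Bg → C.Dom → ℝ) → ι → ℝ} {κ : ℝ} {wt : ℕ → ι → ℝ}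
    {τ : ℕ → ℕ → ℝ} {lam cΦ : ℕ → ℝ} {ℓ cbar τbar ω : ℝ} (h0 : ScaleZeroFree E W)
    (hAdm : AdmissibleTerms E W Adm) (hres : AdmRestrict Adm) (hadd : ChannelAdditive Adm T)
    (hsum : ChannelStepSum Adm T) (hstep : ChannelSizeAtStepNN Adm T κ wt τ)
    (hout : OuterLipschitz E W T κ wt lam cΦ) (hℓ : 0 ≤ ℓ) (hc : 0 ≤ cbar) (hτbar : 0 ≤ τbar) (hω : 0 ≤ ω)
    (hpos : 0 < ω + cbar * τbar) (hlam : ∀ k, lam k ≤ ℓ) (hcΦ : ∀ k, 0 ≤ cΦ k ∧ cΦ k ≤ cbar)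
    (hτ : ∀ k j, j ≤ k → 0 ≤ τ k j ∧ τ k j ≤ τbar * ω ^ (k - j)) :
    NE9 E W κ (prodModuli ℓ fun _ => ω + cbar * τbar) ∧
      FadingMemory (ℓ / (ω + cbar * τbar)) (ω + cbar * τbar) (prodModuli ℓ fun _ => ω + cbar * τbar) :=
  ne9_and_fadingMemory_of_linearChannelNN h0 hAdm hadd (channelSizeNN_of_perStepNN hres hsum hstep) hout hℓ hc hτbar
    hω hpos hlam hcΦ hτ

/-- **THE UNGUARDED PER-STEP BINDER RECOVERED UNDER THE CURE**: if at every creation step `j ≤ k` EITHER the weight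
vanishes (`τ k j = 0`) OR the step is inhabited (some domain of scale j, some background), then `ChannelSizeAtStepNN`
gives back `ChannelSizeAtStep` — at an inhabited step the size hypothesis forces `N ≥ 0`; at a weight-zero step the
guarded bound at `max N 0` already reads `|T| ≤ 0`.  So the `∀ N` of §7 costs nothing beyond the instantiation-side
convention "weight zero where nothing is created" (print: 𝐃_j ≠ ∅ for j ≥ 1, and (0.23) p. 256 of [Balaban1987RG1] creates
nothing at step 0). [folklore] -/
theorem channelSizeAtStep_of_NN {Bg ι : Type} {Adm : Set (Bg → C.Dom → ℝ)}
    {T : ℕ → (ℕ → ℝ) → (Bg → C.Dom → ℝ) → ι → ℝ} {κ : ℝ} {wt : ℕ → ι → ℝ} {τ : ℕ → ℕ → ℝ}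
    (hNN : ChannelSizeAtStepNN Adm T κ wt τ)
    (hcure : ∀ k j, j ≤ k → τ k j = 0 ∨ (Nonempty Bg ∧ ∃ X : C.Dom, C.scale X = j)) :
    ChannelSizeAtStep Adm T κ wt τ := by
  intro k j hjk s H hH hsupp N hN y
  rcases hcure k j hjk with hτ0 | ⟨⟨U₀⟩, X₀, hX₀⟩
  · have h := hNN k j hjk s H hH hsupp (max N 0) (le_max_right _ _)
      (fun U X hX => (hN U X hX).trans
        (mul_le_mul_of_nonneg_left (le_max_left _ _) (Real.exp_pos _).le)) y
    simpa [hτ0] using h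
  · have hN0 : 0 ≤ N := by
      have h := (abs_nonneg _).trans (hN U₀ X₀ hX₀)
      exact nonneg_of_mul_nonneg_right (by simpa [mul_comm] using h) (Real.exp_pos _)
    exact hNN k j hjk s H hH hsupp N hN0 hN y

/-- **THE UNGUARDED WEIGHTED BINDER RECOVERED UNDER THE CURE**: under the same step-wise alternative (weight zero or
inhabited), `ChannelSizeNN` gives back `ChannelSize` — replace `N j` by `max (N j) 0`: the weighted sums agree term by
term (inhabited steps force `N j ≥ 0`, weight-zero steps contribute nothing). [folklore] -/
theorem channelSize_of_NN {Bg ι : Type} {Adm : Set (Bg → C.Dom → ℝ)}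
    {T : ℕ → (ℕ → ℝ) → (Bg → C.Dom → ℝ) → ι → ℝ} {κ : ℝ} {wt : ℕ → ι → ℝ} {τ : ℕ → ℕ → ℝ}
    (hNN : ChannelSizeNN Adm T κ wt τ)
    (hcure : ∀ k j, j ≤ k → τ k j = 0 ∨ (Nonempty Bg ∧ ∃ X : C.Dom, C.scale X = j)) :
    ChannelSize Adm T κ wt τ := by
  intro k s H hH N hN y
  have h := hNN k s H hH (fun j => max (N j) 0) (fun j => le_max_right _ _)
    (fun U X hX => (hN U X hX).trans (mul_le_mul_of_nonneg_left (le_max_left _ _) (Real.exp_pos _).le)) y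
  have hterm : ∀ j ∈ Finset.range (k + 1), τ k j * max (N j) 0 = τ k j * N j := by
    intro j hj
    have hjk : j ≤ k := Nat.lt_succ_iff.mp (Finset.mem_range.mp hj)
    rcases hcure k j hjk with hτ0 | ⟨⟨U₀⟩, X₀, hX₀⟩
    · rw [hτ0, zero_mul, zero_mul]
    · have hN0 : 0 ≤ N j := by
        have h1 := (abs_nonneg _).trans (hN U₀ X₀ (by omega))
        rw [hX₀] at h1
        exact nonneg_of_mul_nonneg_right (by simpa [mul_comm] using h1) (Real.exp_pos _)
      rw [max_eq_left hN0]
  rwa [Finset.sum_congr rfl hterm] at h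

/-- Non-vacuity of §8 on the toy recursion of §5–§7b (`E_{k+1} = g_k + μE_k`, μ > 0): the guarded per-step bound
holds (from `toy_perStep`); every creation step of the toy carriers is inhabited, so the cure applies and RETURNS the
unguarded bound; and the guarded end-to-end theorem reproduces the sharp moduli `μ^{k−1−i}` of `toy_ne9`
(ω = 0, c̄ = μ, τ̄ = 1). [folklore] -/
theorem toy_perStepNN {μ : ℝ} (hμ : 0 < μ) (W : Set (ℕ → ℝ)) :
    ChannelSizeAtStepNN (C := toyCarriers) Set.univ toyChannel 0 (fun _ _ => 1) (fun k j => if j = k then 1 else 0) ∧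
      ChannelSizeAtStep (C := toyCarriers) Set.univ toyChannel 0 (fun _ _ => 1) (fun k j => if j = k then 1 else 0) ∧
      (NE9 (C := toyCarriers) (toyE μ) W 0 (prodModuli 1 fun _ => μ) ∧
        FadingMemory (1 / μ) μ (prodModuli 1 fun _ => μ)) := by
  have hNN := channelSizeAtStepNN_of_channelSizeAtStep toy_perStep.2.2
  have h0 : ScaleZeroFree (C := toyCarriers) (toyE μ) W := by
    intro g _ g' _ u X hX
    change X = 0 at hX
    subst hX
    simp [toyE]
  have hτ : ∀ k j : ℕ, j ≤ k →
      (0 : ℝ) ≤ (if j = k then (1 : ℝ) else 0) ∧ (if j = k then (1 : ℝ) else 0) ≤ 1 * (0 : ℝ) ^ (k - j) := by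
    intro k j _
    by_cases hj : j = k
    · subst hj
      simp
    · rw [if_neg hj]
      exact ⟨le_rfl, by positivity⟩
  obtain ⟨hAdm, hadd, _, hout⟩ := toy_linearChannel hμ.le W
  have h := ne9_and_fadingMemory_of_perStepNN (ω := 0) (cbar := μ) (τbar := 1) h0 hAdm toy_perStep.1 hadd
    toy_perStep.2.1 hNN hout zero_le_one hμ.le zero_le_one le_rfl (by linarith) (fun _ => le_rfl)
    (fun _ => ⟨hμ.le, le_rfl⟩) hτ
  refine ⟨hNN, channelSizeAtStep_of_NN hNN fun k j _ => Or.inr ⟨⟨()⟩, j, rfl⟩, ?_⟩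
  simpa using h

end Literature.MathematicalPhysics.QuantumFieldTheory.Balaban1983to89.T4HistoryLipschitzRecursion

end
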